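import Literature.MathematicalPhysics.QuantumFieldTheory.IsingGaugeQuarkPotential
import Literature.MathematicalPhysics.QuantumFieldTheory.VillainAngleForm
import Literature.Probability.LatticeModels.IsingDisorderFermion
import HarnessLib

/-!
# Duality of the three-dimensional `ℤ₂` lattice gauge theory with free boundary conditions and
# the Ising model with plus boundary conditions and a disorder operator (Aizenman 2025, Thm 9.2)

M. Aizenman, *Geometric analysis of Ising models, Part III*, Math. Phys. Anal. Geom. **28** (2025)
= arXiv:2509.02850 [Aizenman2025], §9.2, **Theorem 9.2**: «For the `ℤ₂` lattice gauge model
(LGM) on `ℤ³`: 1) the LGM's partition function in rectangular subgraphs `Λ ⊂ ℤ³` at inverse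
temperature `β` is simply related to that of the Ising model on the dual `Λ*` at inverse
temperature `β*`, `e^{2β*} = coth β`; 2) under this correspondence, for each simple surface `𝒮`
of plaquettes of `ℤ³` (within `Λ`), `⟨∏_{b ∈ ∂𝒮} A_b⟩^{LGT}_{Λ,β} = ⟨T_𝒮⟩^{Ising}_{Λ*,β*}`, where
`Λ*` is the graph dual of `Λ` and `T_𝒮` is the disorder operator (the sign of the couplings of
the dual bonds crossing `𝒮` reversed).» The printed proof expands the plaquette Gibbs factors
(random currents, eq. (LGM_RCR)), notes that «under the free boundary condition (though not under
the periodic ones) any loop of the dual graph can be presented as a symmetric difference of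
elementary loops» winding around the edges, so that a divergence-free current determines a dual
spin configuration «unique modulo a global spin flip», and reads off `cosh β` / `sinh β` per dual
bond; the torus form of the same computation (Wegner 1971) is the tree's
`IsingGaugeWegnerDuality.lean`, with its sum over `H₂`-twists.

## What is proved (everything; no named fact)

We type item 2) — the statement used in §9.3 of the source and by the `ym-ir` census row A5 —
in the tree's free-boundary `ℤ^d` gauge vocabulary (`zdExpect (znRep 2) β Λ F` of `Sweep1`, the
theory whose cube limits define `znWilsonLoopLimit 2`) and the tree's finite-volume Ising
vocabulary (`isingExpect (zdGraph 3) Λ β h .plus`, `disorderWeight` of `IsingDisorderFermion`):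

* §1 the `±1` plaquette variables `plaqSpin U p` of a `ℤ₂` configuration and the abelian Stokes
  theorem `W_{R×T} = ∏_{p ∈ sheet} σ_p` (`zdWilsonLoop_znRep_two_eq_prod_plaqSpin`);
* §2 the high-temperature (tanh) expansion of the `ℤ₂` plaquette weight,
  `e^{-β S_Λ} = (e^{-β} cosh β)^{|P|} ∑_{n ⊆ P} (tanh β)^{|n|} σ^n` (`exp_neg_mul_zdWilsonAction_z2`);
* §3 the Haar integral of a product of plaquette variables is `1` or `0` according as every bond
  is used an even number of times (`integral_zdHaar_prod_plaqSpin`; the vanishing by the centre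
  twist `U_e ↦ -U_e` of one odd bond, `integral_zdHaar_comp_twist`);
* §4 hence the surface (closed `2`-chain) representation of free-boundary expectations of products
  of plaquette variables, in particular of Wilson loops
  (`zdExpect_z2_prod_plaqSpin_eq`) — the `{0,1}`-valued form of Aizenman's (LGM_RCR);
* §5 for the site box `gaugeBox M = {-M, …, M+1}³`, whose plaquettes are exactly the faces of the
  unit cubes with lower corners in `box 3 M` (`mem_faces_iff`), every closed `2`-chain is the
  coboundary `cobd` of a unique set of cubes (`H₂ = 0` with free boundary conditions:
  `cobd_sweep`, `sweep_cobd`, `isClosed_cobd`, `sum_closed_eq_sum_powerset_box`), by the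
  column-parity («integrate along the vertical») construction `sweep`;
* §6 the dictionary face `(z; i, j) ↦` dual bond `{z - e_k, z}` (`k` the third direction,
  `dualEdge`) between `plaquettesIn (gaugeBox M)` and the bonds `ℰ^b_{box 3 M}` of the plus-boundary
  Ising model (`image_dualEdge_faces`), the weights `(tanh β)^{|S ∆ δc|} = const · w⁺_{β*} · μ_{S*}`
  (`tanh_pow_card_symmDiff_cobd`), and the main theorems
  `zdExpect_z2_prod_plaqSpin_eq_isingExpect_plus_disorderWeight` /
  `zdExpect_z2_wilsonLoop_eq_isingExpect_plus_disorderWeight` (Thm 9.2 (2)):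
  `⟨∏_{p ∈ S} A_{∂p}⟩^{free}_{gaugeBox M, β} = ⟨exp(-2β* ∑_{e ∈ S*} σ_e)⟩^{+}_{box 3 M, β*}`,
  `e^{-2β*} = tanh β` (`dualBeta`), for every set `S` of faces, and
  `integral_exp_neg_zdWilsonAction_z2_eq` (Thm 9.2 (1), partition functions) — the dual of the FREE
  gauge box is the PLUS (wired) Ising box: the exterior cubes form one frozen `+` block.

HONEST FRAMING: an exact finite-volume identity for the abelian group `ℤ₂` in three dimensions
(census row A5 of cell `ym-ir`, calibration); nothing here bears on four-dimensional Yang–Mills,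
on `BalabanLadder.IR`, or on the mass gap (Clay). In the `ym` ladder only the conditional
finite-`𝕋⁴` rung `BalabanLadder.UV` is closed by any route.

## References

* M. Aizenman, Math. Phys. Anal. Geom. 28 (2025), arXiv:2509.02850, §9.2 Thm 9.2 and its proof
  (eqs. (LGM_RCR), (48), (eq:curl), (Z_coth), (Sdual)) [Aizenman2025].
* F. J. Wegner, J. Math. Phys. 12 (1971) 2259–2272, §III (duality of `M_{3,2}` and the Ising
  model) [Wegner1971].
* R. Balian, J. M. Drouffe, C. Itzykson, Phys. Rev. D 11 (1975) 2098, §III [BalianDrouffeItzykson1975].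
-/

noncomputable section

open MeasureTheory Finset Filter
open scoped symmDiff
open Literature.Probability.LatticeModels
open Literature.Barriers.QuantumFields (rootsOfUnityCircle mem_rootsOfUnityCircle znRep znRep_apply
  continuous_znRep)

namespace Literature.MathematicalPhysics.QuantumFieldTheory

open AreaLaw

namespace Z2Duality

/-! ### §1 `ℤ₂` bond and plaquette variables; abelian Stokes -/

section Spins

variable {d : ℕ}

/-- Elements of `ℤ₂ ⊂ U(1)` are their own inverses. [cite: Aizenman2025, §9.1 (A_b ∈ ℤ₂ realised as {-1,1})] -/
theorem z2_inv_eq_self (z : ↥(rootsOfUnityCircle 2)) : z⁻¹ = z := by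
  have hz : (z : Circle) ^ 2 = 1 := mem_rootsOfUnityCircle.1 z.2
  have hzz : z * z = 1 := by
    apply Subtype.ext
    rw [Subgroup.coe_mul, ← sq, hz, Subgroup.coe_one]
  exact inv_eq_of_mul_eq_one_right hzz

/-- The bond variable `A_b = Re U_b ∈ {±1}` of a `ℤ₂` gauge configuration.
[cite: Aizenman2025, §9.1 (the variables A_b)] -/
def bondVar (U : ZdGaugeConfig d ↥(rootsOfUnityCircle 2)) (e : ZdEdge d) : ℝ :=
  (((U e : ↥(rootsOfUnityCircle 2)) : Circle) : ℂ).re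

/-- The plaquette variable `A_{∂p} = ∏_{b ∈ ∂p} A_b = Re U_p ∈ {±1}`.
[cite: Aizenman2025, §9.1 (H = -∑_p ∏_{b ∈ ∂p} A_b)] -/
def plaqSpin (U : ZdGaugeConfig d ↥(rootsOfUnityCircle 2)) (p : Plaq d) : ℝ :=
  (((U.plaquette p.1 p.2.1 p.2.2 : ↥(rootsOfUnityCircle 2)) : Circle) : ℂ).re

/-- `A_b ∈ {1, -1}`. [cite: Aizenman2025, §9.1] -/
theorem bondVar_eq_one_or (U : ZdGaugeConfig d ↥(rootsOfUnityCircle 2)) (e : ZdEdge d) :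
    bondVar U e = 1 ∨ bondVar U e = -1 :=
  re_coe_rootsOfUnityCircle_two _

/-- `A_b² = 1`. [cite: Aizenman2025, §9.1] -/
theorem bondVar_mul_self (U : ZdGaugeConfig d ↥(rootsOfUnityCircle 2)) (e : ZdEdge d) :
    bondVar U e * bondVar U e = 1 := by
  rcases bondVar_eq_one_or U e with h | h <;> rw [h] <;> norm_num

/-- `A_{∂p} ∈ {1, -1}`. [cite: Aizenman2025, §9.1] -/
theorem plaqSpin_eq_one_or (U : ZdGaugeConfig d ↥(rootsOfUnityCircle 2)) (p : Plaq d) :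
    plaqSpin U p = 1 ∨ plaqSpin U p = -1 :=
  re_coe_rootsOfUnityCircle_two _

/-- `A_{∂p}² = 1`. [cite: Aizenman2025, §9.1] -/
theorem plaqSpin_mul_self (U : ZdGaugeConfig d ↥(rootsOfUnityCircle 2)) (p : Plaq d) :
    plaqSpin U p * plaqSpin U p = 1 := by
  rcases plaqSpin_eq_one_or U p with h | h <;> rw [h] <;> norm_num

/-- `|A_{∂p}| ≤ 1`. [cite: Aizenman2025, §9.1] -/
theorem abs_plaqSpin_le (U : ZdGaugeConfig d ↥(rootsOfUnityCircle 2)) (p : Plaq d) :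
    |plaqSpin U p| ≤ 1 := by
  rcases plaqSpin_eq_one_or U p with h | h <;> rw [h] <;> norm_num

/-- The four bond slots of the plaquette label `(x; i, j)`, in the order of `Plaq.bonds`:
`(x,i), (x+eᵢ,j), (x+eⱼ,i), (x,j)`. [cite: Aizenman2025, §9.1 (∂p consists of four edges)] -/
def slot (p : Plaq d) : Fin 4 → ZdEdge d :=
  ![(p.1, p.2.1), (p.1 + Pi.single p.2.1 1, p.2.2), (p.1 + Pi.single p.2.2 1, p.2.1), (p.1, p.2.2)]

/-- Plumbing. [folklore] -/
@[simp] private theorem slot_zero (p : Plaq d) : slot p 0 = (p.1, p.2.1) := rfl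
/-- Plumbing. [folklore] -/
@[simp] private theorem slot_one (p : Plaq d) : slot p 1 = (p.1 + Pi.single p.2.1 1, p.2.2) := rfl
/-- Plumbing. [folklore] -/
@[simp] private theorem slot_two (p : Plaq d) : slot p 2 = (p.1 + Pi.single p.2.2 1, p.2.1) := rfl
/-- Plumbing. [folklore] -/
@[simp] private theorem slot_three (p : Plaq d) : slot p 3 = (p.1, p.2.2) := rfl

/-- The bonds of a plaquette are its four slots. [cite: Aizenman2025, §9.1] -/
theorem mem_bonds_iff_exists_slot (p : Plaq d) (e : ZdEdge d) : e ∈ p.bonds ↔ ∃ s, slot p s = e := by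
  simp only [Plaq.bonds, Finset.mem_insert, Finset.mem_singleton, Fin.exists_fin_succ, slot,
    Matrix.cons_val_zero, Matrix.cons_val_succ, Matrix.cons_val_fin_one,
    IsEmpty.exists_iff, or_false]
  constructor
  · rintro (h | h | h | h) <;> simp [h]
  · rintro (h | h | h | h) <;> simp [← h]

/-- Real parts are multiplicative on `ℤ₂`: `Re` is a monoid hom `ℤ₂ → ℝ`. [cite: Aizenman2025, §9.1] -/
theorem re_coe_prod {ι : Type*} (s : Finset ι) (f : ι → ↥(rootsOfUnityCircle 2)) :
    ((((∏ i ∈ s, f i : ↥(rootsOfUnityCircle 2))) : Circle) : ℂ).re =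
      ∏ i ∈ s, (((f i : ↥(rootsOfUnityCircle 2)) : Circle) : ℂ).re := by
  classical
  induction s using Finset.induction_on with
  | empty => simp
  | insert a s ha ih => rw [Finset.prod_insert ha, Finset.prod_insert ha, re_coe_mul_rootsOfUnityCircle_two, ih]

/-- **`A_{∂p} = ∏_{b ∈ ∂p} A_b`**: the plaquette variable is the product of its four bond
variables (in `ℤ₂` inverses are trivial). [cite: Aizenman2025, §9.1 (A_{∂p} = A_{ij}A_{jk}A_{kl}A_{li})] -/
theorem plaqSpin_eq_prod_slot (U : ZdGaugeConfig d ↥(rootsOfUnityCircle 2)) (p : Plaq d) :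
    plaqSpin U p = ∏ s : Fin 4, bondVar U (slot p s) := by
  rw [Fin.prod_univ_four]
  simp only [plaqSpin, ZdGaugeConfig.plaquette, z2_inv_eq_self, re_coe_mul_rootsOfUnityCircle_two,
    bondVar, slot_zero, slot_one, slot_two, slot_three]

/-- The bond variables are continuous functions of the configuration. [folklore] -/
private theorem continuous_bondVar (e : ZdEdge d) : Continuous fun U : ZdGaugeConfig d ↥(rootsOfUnityCircle 2) => bondVar U e :=
  Complex.continuous_re.comp (continuous_subtype_val.comp (continuous_subtype_val.comp (continuous_apply e)))

/-- The plaquette variables are continuous functions of the configuration. [folklore] -/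
private theorem continuous_plaqSpin (p : Plaq d) : Continuous fun U : ZdGaugeConfig d ↥(rootsOfUnityCircle 2) => plaqSpin U p := by
  simp_rw [plaqSpin_eq_prod_slot]
  exact continuous_finsetProd _ fun s _ => continuous_bondVar _

/-- Products of plaquette variables are continuous. [folklore] -/
private theorem continuous_prod_plaqSpin (Q : Finset (Plaq d)) :
    Continuous fun U : ZdGaugeConfig d ↥(rootsOfUnityCircle 2) => ∏ p ∈ Q, plaqSpin U p :=
  continuous_finsetProd _ fun p _ => continuous_plaqSpin p

/-- A product of plaquette variables is `±1`. [cite: Aizenman2025, §9.1] -/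
theorem prod_plaqSpin_eq_one_or (U : ZdGaugeConfig d ↥(rootsOfUnityCircle 2)) (Q : Finset (Plaq d)) :
    ∏ p ∈ Q, plaqSpin U p = 1 ∨ ∏ p ∈ Q, plaqSpin U p = -1 := by
  classical
  induction Q using Finset.induction_on with
  | empty => simp
  | insert a s ha ih =>
    rw [Finset.prod_insert ha]
    rcases plaqSpin_eq_one_or U a with h | h <;> rcases ih with h' | h' <;> simp [h, h']

/-- `|∏_{p ∈ Q} A_{∂p}| ≤ 1`. [cite: Aizenman2025, §9.1] -/
theorem abs_prod_plaqSpin_le (U : ZdGaugeConfig d ↥(rootsOfUnityCircle 2)) (Q : Finset (Plaq d)) :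
    |∏ p ∈ Q, plaqSpin U p| ≤ 1 := by
  rcases prod_plaqSpin_eq_one_or U Q with h | h <;> rw [h] <;> norm_num

/-- For `±1`-valued factors, `(∏_S f)(∏_T f) = ∏_{S ∆ T} f`. [folklore] -/
private theorem prod_mul_prod_eq_prod_symmDiff {ι : Type*} [DecidableEq ι] (S T : Finset ι) (f : ι → ℝ)
    (hf : ∀ i, f i * f i = 1) : (∏ i ∈ S, f i) * ∏ i ∈ T, f i = ∏ i ∈ S ∆ T, f i := by
  have eS : ∏ i ∈ S, f i = (∏ i ∈ S \ T, f i) * ∏ i ∈ S ∩ T, f i := by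
    rw [← Finset.prod_sdiff Finset.inter_subset_left, Finset.sdiff_inter_self_left]
  have eT : ∏ i ∈ T, f i = (∏ i ∈ T \ S, f i) * ∏ i ∈ S ∩ T, f i := by
    rw [← Finset.prod_sdiff Finset.inter_subset_right, Finset.sdiff_inter_self_right]
  have h3 : Disjoint (S \ T) (T \ S) := disjoint_sdiff_sdiff
  have hsq : (∏ i ∈ S ∩ T, f i) * ∏ i ∈ S ∩ T, f i = 1 := by
    rw [← Finset.prod_mul_distrib]; exact Finset.prod_eq_one fun i _ => hf i
  rw [eS, eT, symmDiff_def, Finset.sup_eq_union, Finset.prod_union h3]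
  calc (∏ x ∈ S \ T, f x) * (∏ x ∈ S ∩ T, f x) * ((∏ x ∈ T \ S, f x) * ∏ x ∈ S ∩ T, f x)
      = (∏ x ∈ S \ T, f x) * (∏ x ∈ T \ S, f x) * ((∏ i ∈ S ∩ T, f i) * ∏ i ∈ S ∩ T, f i) := by ring
    _ = (∏ x ∈ S \ T, f x) * ∏ x ∈ T \ S, f x := by rw [hsq, mul_one]

/-- `(∏_{p ∈ S} A_{∂p})(∏_{p ∈ T} A_{∂p}) = ∏_{p ∈ S ∆ T} A_{∂p}` (`ℤ₂`: only parities matter).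
[cite: Aizenman2025, §9.2 (proof of Thm 9.2 (2): the insertion flips the parity rule on S)] -/
theorem prod_plaqSpin_mul_prod_plaqSpin (U : ZdGaugeConfig d ↥(rootsOfUnityCircle 2)) (S T : Finset (Plaq d)) :
    (∏ p ∈ S, plaqSpin U p) * ∏ p ∈ T, plaqSpin U p = ∏ p ∈ S ∆ T, plaqSpin U p := by
  classical
  exact prod_mul_prod_eq_prod_symmDiff S T _ (plaqSpin_mul_self U)

/-- Straight-line holonomies commute with group homomorphisms. [folklore] -/
private theorem line_comp_hom {G H : Type*} [Group G] [Group H] (f : G →* H) (U : ZdGaugeConfig d G)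
    (k : Fin d) (n : ℕ) (y : Probability.LatticeModels.Site d) :
    ZdGaugeConfig.line (fun e => f (U e)) k n y = f (U.line k n y) := by
  induction n generalizing y with
  | zero => simp [ZdGaugeConfig.line]
  | succ n ih => simp [ZdGaugeConfig.line, ih, map_mul]

/-- Rectangular holonomies commute with group homomorphisms. [folklore] -/
private theorem rectangle_comp_hom {G H : Type*} [Group G] [Group H] (f : G →* H) (U : ZdGaugeConfig d G)
    (x : Probability.LatticeModels.Site d) (i j : Fin d) (R T : ℕ) :
    ZdGaugeConfig.rectangle (fun e => f (U e)) x i j R T = f (U.rectangle x i j R T) := by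
  simp only [ZdGaugeConfig.rectangle, line_comp_hom, map_mul, map_inv]

/-- Plaquette holonomies commute with group homomorphisms. [folklore] -/
private theorem plaquette_comp_hom {G H : Type*} [Group G] [Group H] (f : G →* H) (U : ZdGaugeConfig d G)
    (x : Probability.LatticeModels.Site d) (i j : Fin d) :
    ZdGaugeConfig.plaquette (fun e => f (U e)) x i j = f (U.plaquette x i j) := by
  simp only [ZdGaugeConfig.plaquette, map_mul, map_inv]

/-- **Abelian Stokes in `ℤ₂`**: `U_γ = ∏_{p ∈ sheet} U_p` for the `R × T` rectangle (`i ≠ j`),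
transferred from the tree's `U(1)` statement `rectangle_eq_prod_plaquette`.
[cite: Aizenman2025, §9.2 (proof of Thm 9.2 (2): ∏_{b ∈ ∂𝒮} A_b = ∏_{p ∈ 𝒮} A_{∂p})] -/
theorem rectangle_eq_prod_plaquette_z2 (U : ZdGaugeConfig d ↥(rootsOfUnityCircle 2))
    (x : Probability.LatticeModels.Site d) {i j : Fin d} (hij : i ≠ j) (R T : ℕ) :
    U.rectangle x i j R T = ∏ p ∈ rectPlaqs x i j R T, U.plaquette p.1 p.2.1 p.2.2 := by
  apply Subtype.ext
  have h := VillainAngle.rectangle_eq_prod_plaquette (fun e => ((rootsOfUnityCircle 2).subtype (U e))) x hij R T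
  rw [rectangle_comp_hom] at h
  change (rootsOfUnityCircle 2).subtype (U.rectangle x i j R T) =
    (rootsOfUnityCircle 2).subtype (∏ p ∈ rectPlaqs x i j R T, U.plaquette p.1 p.2.1 p.2.2)
  rw [h, map_prod]
  exact Finset.prod_congr rfl fun p _ => plaquette_comp_hom _ U _ _ _

/-- The `ℤ₂` Wilson loop observable is the real part of the loop holonomy,
`W_γ(U) = Re U_γ = ∏_{b ∈ γ} A_b`. [cite: Aizenman2025, §9.1 (A_γ = ∏_{b ∈ γ} A_b)] -/
theorem zdWilsonLoop_znRep_two_eq_re (x : Probability.LatticeModels.Site d) (i j : Fin d) (R T : ℕ)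
    (U : ZdGaugeConfig d ↥(rootsOfUnityCircle 2)) :
    zdWilsonLoop (znRep 2) x i j R T U = (((U.rectangle x i j R T : ↥(rootsOfUnityCircle 2)) : Circle) : ℂ).re := by
  rw [← charRep_znIncl]
  unfold zdWilsonLoop
  rw [trace_charRep_re, znIncl_apply, Nat.cast_one, inv_one, one_mul]

/-- **The Wilson loop as a surface observable**: `W_{R×T}(U) = ∏_{p ∈ sheet} A_{∂p}(U)` (`i ≠ j`).
[cite: Aizenman2025, §9.2 (Thm 9.2 (2): ⟨∏_{b ∈ ∂𝒮} A_b⟩ for the surface 𝒮 spanning γ)] -/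
theorem zdWilsonLoop_znRep_two_eq_prod_plaqSpin (x : Probability.LatticeModels.Site d) {i j : Fin d} (hij : i ≠ j)
    (R T : ℕ) (U : ZdGaugeConfig d ↥(rootsOfUnityCircle 2)) :
    zdWilsonLoop (znRep 2) x i j R T U = ∏ p ∈ rectPlaqs x i j R T, plaqSpin U p := by
  rw [zdWilsonLoop_znRep_two_eq_re, rectangle_eq_prod_plaquette_z2 U x hij, re_coe_prod]
  rfl

end Spins

/-! ### §2 The high-temperature expansion of the `ℤ₂` plaquette weight -/

section HighTemperature

variable {d : ℕ}

/-- The Wilson action of the `ℤ₂` theory: `S_Λ(U) = ∑_{p ∈ Λ'} (1 - A_{∂p})`.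
[cite: Aizenman2025, §9.1 (eq. (H_LGM), H = -∑_p ∏_{b∈∂p} A_b)] -/
theorem zdWilsonAction_znRep_two (Λ : Finset (Probability.LatticeModels.Site d))
    (U : ZdGaugeConfig d ↥(rootsOfUnityCircle 2)) :
    zdWilsonAction (znRep 2) Λ U = ∑ p ∈ plaquettesIn Λ, (1 - plaqSpin U p) := by
  unfold zdWilsonAction
  refine Finset.sum_congr rfl fun p _ => ?_
  rw [← charRep_znIncl, trace_charRep_re, znIncl_apply, Nat.cast_one]
  rfl

/-- One plaquette: `e^{-β(1 - s)} = (e^{-β} cosh β)(1 + s tanh β)` for `s = ±1` — the `{0,1}`-current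
form of the expansion of the Gibbs factor («`cosh β` for … equal spins, `sinh β` for pairs with
opposite spins»). [cite: Aizenman2025, §9.2 (proof of Thm 9.2 (1), the cosh/sinh factors)] -/
theorem exp_neg_mul_one_sub_eq {β s : ℝ} (hs : s = 1 ∨ s = -1) :
    Real.exp (-β * (1 - s)) = (Real.exp (-β) * Real.cosh β) * (1 + Real.tanh β * s) := by
  have hc : Real.cosh β ≠ 0 := (Real.cosh_pos β).ne'
  rw [Real.tanh_eq_sinh_div_cosh]
  rcases hs with rfl | rfl
  · have h1 : Real.cosh β * (1 + Real.sinh β / Real.cosh β * 1) = Real.exp β := by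
      field_simp; linarith [Real.cosh_add_sinh β]
    rw [mul_assoc, h1, ← Real.exp_add]; norm_num
  · have h1 : Real.cosh β * (1 + Real.sinh β / Real.cosh β * (-1)) = Real.exp (-β) := by
      field_simp; linarith [Real.cosh_sub_sinh β]
    rw [mul_assoc, h1, ← Real.exp_add]; ring_nf

/-- **High-temperature expansion of the `ℤ₂` plaquette weight**:
`e^{-β S_Λ(U)} = (e^{-β} cosh β)^{|P|} ∑_{n ⊆ P} (tanh β)^{|n|} ∏_{p ∈ n} A_{∂p}(U)`, `P` the plaquettes
of `Λ`. [cite: Aizenman2025, §9.2 (proof of Thm 9.2 (1), eq. (LGM_RCR))] -/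
theorem exp_neg_mul_zdWilsonAction_z2 (β : ℝ) (Λ : Finset (Probability.LatticeModels.Site d))
    (U : ZdGaugeConfig d ↥(rootsOfUnityCircle 2)) :
    Real.exp (-β * zdWilsonAction (znRep 2) Λ U) =
      (Real.exp (-β) * Real.cosh β) ^ #(plaquettesIn Λ) *
        ∑ n ∈ (plaquettesIn Λ).powerset, Real.tanh β ^ #n * ∏ p ∈ n, plaqSpin U p := by
  rw [zdWilsonAction_znRep_two, Finset.mul_sum, Real.exp_sum]
  have h : ∀ p ∈ plaquettesIn Λ, Real.exp (-β * (1 - plaqSpin U p)) =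
      (Real.exp (-β) * Real.cosh β) * (1 + Real.tanh β * plaqSpin U p) :=
    fun p _ => exp_neg_mul_one_sub_eq (plaqSpin_eq_one_or U p)
  rw [Finset.prod_congr rfl h, Finset.prod_mul_distrib, Finset.prod_const, Finset.prod_one_add]
  congr 1
  refine Finset.sum_congr rfl fun n _ => ?_
  rw [Finset.prod_mul_distrib, Finset.prod_const]

end HighTemperature

/-! ### §3 Haar integrals of products of plaquette variables: closed `2`-chains -/

section Closed

variable {d : ℕ}

/-- The `ℤ₂`-boundary of a set `Q` of plaquettes at the bond `e`: the number (mod 2) of bond slots of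
plaquettes of `Q` occupied by `e` — the parity «`∑_{p : b ∈ ∂p} n(p)`» of the source, for the
`{0,1}`-valued current `n = 1_Q`. [cite: Aizenman2025, §9.2 (eq. (48), the boundary ∂𝐧)] -/
def bdry (Q : Finset (Plaq d)) (e : ZdEdge d) : ZMod 2 :=
  ∑ p ∈ Q, ∑ s : Fin 4, if slot p s = e then 1 else 0

/-- `Q` is a **closed `2`-chain** (`∂𝐧 = ∅`): every bond is used an even number of times.
[cite: Aizenman2025, §9.2 (eq. (48): ∂𝐧 = {b : (-1)^{∑_{p : b ∈ ∂p} n(p)} = -1} = ∅)] -/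
def IsClosed (Q : Finset (Plaq d)) : Prop := ∀ e, bdry Q e = 0

/-- `∂` is additive: `bdry (insert a Q) = bdry {a} + bdry Q`-type bookkeeping via sums over `Q`.
[cite: Aizenman2025, §9.2 (eq. (48))] -/
theorem bdry_eq_sum_product (Q : Finset (Plaq d)) (e : ZdEdge d) :
    bdry Q e = ∑ a ∈ Q ×ˢ (Finset.univ : Finset (Fin 4)), if slot a.1 a.2 = e then 1 else 0 := by
  rw [bdry, Finset.sum_product]

/-- The boundary at `e` is the parity of the number of occupied slots equal to `e`.
[cite: Aizenman2025, §9.2 (eq. (48))] -/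
theorem bdry_eq_card (Q : Finset (Plaq d)) (e : ZdEdge d) :
    bdry Q e = (#((Q ×ˢ (Finset.univ : Finset (Fin 4))).filter fun a => slot a.1 a.2 = e) : ZMod 2) := by
  rw [bdry_eq_sum_product, Finset.sum_boole]

/-- `∂(S ∆ T) = ∂S + ∂T`. [cite: Aizenman2025, §9.2 (symmetric differences of loops, proof of Thm 9.2)] -/
theorem bdry_symmDiff (S T : Finset (Plaq d)) (e : ZdEdge d) : bdry (S ∆ T) e = bdry S e + bdry T e := by
  classical
  set g : Plaq d → ZMod 2 := fun p => ∑ s : Fin 4, if slot p s = e then 1 else 0 with hg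
  have eS : ∑ i ∈ S, g i = ∑ i ∈ S \ T, g i + ∑ i ∈ S ∩ T, g i := by
    rw [← Finset.sum_sdiff Finset.inter_subset_left, Finset.sdiff_inter_self_left]
  have eT : ∑ i ∈ T, g i = ∑ i ∈ T \ S, g i + ∑ i ∈ S ∩ T, g i := by
    rw [← Finset.sum_sdiff Finset.inter_subset_right, Finset.sdiff_inter_self_right]
  have h3 : Disjoint (S \ T) (T \ S) := disjoint_sdiff_sdiff
  have two : ∀ x : ZMod 2, x + x = 0 := by decide
  show ∑ p ∈ S ∆ T, g p = ∑ p ∈ S, g p + ∑ p ∈ T, g p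
  rw [eS, eT, symmDiff_def, Finset.sup_eq_union, Finset.sum_union h3]
  rw [show ∀ a b c : ZMod 2, a + c + (b + c) = a + b + (c + c) from fun a b c => by ring, two, add_zero]

/-- The symmetric difference of closed chains is closed. [cite: Aizenman2025, §9.2] -/
theorem IsClosed.symmDiff {S T : Finset (Plaq d)} (hS : IsClosed S) (hT : IsClosed T) : IsClosed (S ∆ T) :=
  fun e => by rw [bdry_symmDiff, hS e, hT e, add_zero]

/-- If `S ∆ T` and `T` are closed then so is `S`. [cite: Aizenman2025, §9.2] -/
theorem IsClosed.of_symmDiff {S T : Finset (Plaq d)} (hST : IsClosed (S ∆ T)) (hT : IsClosed T) : IsClosed S := by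
  have := hST.symmDiff hT
  rwa [symmDiff_assoc, symmDiff_self, symmDiff_bot] at this

/-- The empty chain is closed. [cite: Aizenman2025, §9.2] -/
theorem isClosed_empty : IsClosed (∅ : Finset (Plaq d)) := fun e => by simp [bdry]

/-- **A product of plaquette variables over a closed chain is identically `1`** (every bond
variable appears an even number of times and `A_b² = 1`). [cite: Aizenman2025, §9.2 (proof of Thm 9.2 (1): only ∂𝐧 = ∅ survives)] -/
theorem prod_plaqSpin_eq_one_of_isClosed {Q : Finset (Plaq d)} (hQ : IsClosed Q)
    (U : ZdGaugeConfig d ↥(rootsOfUnityCircle 2)) : ∏ p ∈ Q, plaqSpin U p = 1 := by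
  classical
  simp_rw [plaqSpin_eq_prod_slot]
  rw [← Finset.prod_product (s := Q) (t := Finset.univ) (f := fun a => bondVar U (slot a.1 a.2))]
  rw [Finset.prod_comp (bondVar U) fun a : Plaq d × Fin 4 => slot a.1 a.2]
  refine Finset.prod_eq_one fun e _ => ?_
  have heven : Even #((Q ×ˢ (Finset.univ : Finset (Fin 4))).filter fun a => slot a.1 a.2 = e) := by
    rw [← ZMod.natCast_eq_zero_iff_even, ← bdry_eq_card]; exact hQ e
  obtain ⟨k, hk⟩ := heven
  rw [hk, ← two_mul, pow_mul, sq, bondVar_mul_self, one_pow]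

variable [DecidableEq (ZdEdge d)]

/-- The centre twist `U_{e₀} ↦ -U_{e₀}` flips the bond variable at `e₀` only. [folklore] -/
private theorem bondVar_twist (e₀ : ZdEdge d) (U : ZdGaugeConfig d ↥(rootsOfUnityCircle 2)) (e : ZdEdge d) :
    bondVar (twist ({e₀} : Set (ZdEdge d)) z2gen U) e = (if e = e₀ then -1 else 1) * bondVar U e := by
  by_cases h : e = e₀
  · subst h
    rw [bondVar, twist_apply_of_mem (Set.mem_singleton e), re_coe_z2gen_mul, if_pos rfl, bondVar]; ring
  · rw [bondVar, twist_apply_of_not_mem (by simpa using h), if_neg h, one_mul, bondVar]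

/-- Under the twist at `e₀`, a product of plaquette variables picks up the sign `(-1)^{∂Q(e₀)}`.
[cite: Aizenman2025, §9.2 (proof of Thm 9.2 (1))] -/
theorem prod_plaqSpin_twist (Q : Finset (Plaq d)) (e₀ : ZdEdge d) (U : ZdGaugeConfig d ↥(rootsOfUnityCircle 2)) :
    ∏ p ∈ Q, plaqSpin (twist ({e₀} : Set (ZdEdge d)) z2gen U) p =
      (-1) ^ #((Q ×ˢ (Finset.univ : Finset (Fin 4))).filter fun a => slot a.1 a.2 = e₀) *
        ∏ p ∈ Q, plaqSpin U p := by
  simp_rw [plaqSpin_eq_prod_slot]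
  rw [← Finset.prod_product (s := Q) (t := Finset.univ)
      (f := fun a => bondVar (twist ({e₀} : Set (ZdEdge d)) z2gen U) (slot a.1 a.2)),
    ← Finset.prod_product (s := Q) (t := Finset.univ) (f := fun a => bondVar U (slot a.1 a.2))]
  simp_rw [bondVar_twist]
  rw [Finset.prod_mul_distrib, Finset.prod_ite, Finset.prod_const, Finset.prod_const_one, mul_one]

omit [DecidableEq (ZdEdge d)] in
open scoped Classical in
/-- **Haar integral of a product of plaquette variables**: `∫ ∏_{p ∈ Q} A_{∂p} dg_∞ = 1` if `Q` is a
closed `2`-chain and `= 0` otherwise (twist one odd bond by `-1 ∈ ℤ₂`: the integrand changes sign,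
the Haar measure does not). [cite: Aizenman2025, §9.2 (proof of Thm 9.2 (1): Z = ∑_𝐧 w(𝐧) 1[∂𝐧 = ∅])] -/
theorem integral_zdHaar_prod_plaqSpin (Q : Finset (Plaq d)) :
    ∫ U, ∏ p ∈ Q, plaqSpin U p ∂zdHaar d ↥(rootsOfUnityCircle 2) = if IsClosed Q then 1 else 0 := by
  split_ifs with hQ
  · simp_rw [prod_plaqSpin_eq_one_of_isClosed hQ]
    simp
  · obtain ⟨e₀, he₀⟩ := not_forall.1 hQ
    have hodd : Odd #((Q ×ˢ (Finset.univ : Finset (Fin 4))).filter fun a => slot a.1 a.2 = e₀) := by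
      rw [← ZMod.natCast_eq_one_iff_odd, ← bdry_eq_card]
      have : ∀ x : ZMod 2, x ≠ 0 → x = 1 := by decide
      exact this _ he₀
    set I := ∫ U, ∏ p ∈ Q, plaqSpin U p ∂zdHaar d ↥(rootsOfUnityCircle 2) with hI
    have hm : AEStronglyMeasurable (fun U : ZdGaugeConfig d ↥(rootsOfUnityCircle 2) => ∏ p ∈ Q, plaqSpin U p)
        (zdHaar d ↥(rootsOfUnityCircle 2)) :=
      (continuous_prod_plaqSpin Q).aestronglyMeasurable
    have h := integral_zdHaar_comp_twist ({e₀} : Set (ZdEdge d)) z2gen hm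
    simp_rw [prod_plaqSpin_twist Q e₀, hodd.neg_one_pow] at h
    rw [integral_const_mul] at h
    linarith

end Closed

/-! ### §4 The surface representation of free-boundary `ℤ₂` expectations -/

section Surface

variable {d : ℕ}

open scoped Classical in
/-- **Numerators as sums over closed `2`-chains**: for `S ⊆ P = Λ'`,
`∫ (∏_{p∈S} A_{∂p}) e^{-βS_Λ} dg_∞ = (e^{-β}cosh β)^{|P|} ∑_{n ⊆ P, ∂(S ∆ n) = ∅} (tanh β)^{|n|}`.
[cite: Aizenman2025, §9.2 (proof of Thm 9.2 (2): the insertion flips the parity rule on S)] -/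
theorem integral_prod_plaqSpin_mul_exp (β : ℝ) (Λ : Finset (Probability.LatticeModels.Site d))
    (S : Finset (Plaq d)) :
    ∫ U, (∏ p ∈ S, plaqSpin U p) * Real.exp (-β * zdWilsonAction (znRep 2) Λ U) ∂zdHaar d ↥(rootsOfUnityCircle 2) =
      (Real.exp (-β) * Real.cosh β) ^ #(plaquettesIn Λ) *
        ∑ n ∈ (plaquettesIn Λ).powerset with IsClosed (S ∆ n), Real.tanh β ^ #n := by
  set P := plaquettesIn Λ with hP
  set c := (Real.exp (-β) * Real.cosh β) ^ #P with hc
  have hpt : ∀ U : ZdGaugeConfig d ↥(rootsOfUnityCircle 2),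
      (∏ p ∈ S, plaqSpin U p) * Real.exp (-β * zdWilsonAction (znRep 2) Λ U) =
        ∑ n ∈ P.powerset, c * (Real.tanh β ^ #n * ∏ p ∈ S ∆ n, plaqSpin U p) := by
    intro U
    rw [exp_neg_mul_zdWilsonAction_z2, ← hP, ← hc, Finset.mul_sum, Finset.mul_sum]
    refine Finset.sum_congr rfl fun n _ => ?_
    rw [← prod_plaqSpin_mul_prod_plaqSpin]; ring
  simp_rw [hpt]
  rw [integral_finsetSum _ fun n _ => ?_]
  swap
  · exact (integrable_zdHaar_of_continuous ((continuous_prod_plaqSpin _).const_mul _)).const_mul _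
  simp_rw [integral_const_mul, integral_zdHaar_prod_plaqSpin, mul_ite, mul_one, mul_zero]
  rw [Finset.mul_sum, Finset.sum_filter]

open scoped Classical in
/-- **The surface representation of free-boundary `ℤ₂` expectations** (Aizenman's (LGM_RCR) with
`{0,1}`-currents; Wegner 1971): for every region `Λ` with plaquettes `P` and every `S ⊆ P`,
`⟨∏_{p ∈ S} A_{∂p}⟩_{Λ,β} = ∑_{n ⊆ P, ∂n = ∂S} (tanh β)^{|n|} / ∑_{n ⊆ P, ∂n = ∅} (tanh β)^{|n|}`
(the closed chains `n` are substituted as `S ∆ n`). [cite: Aizenman2025, §9.2 (proof of Thm 9.2, eqs. (LGM_RCR) and (Sdual))] -/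
theorem zdExpect_z2_prod_plaqSpin_eq (β : ℝ) (Λ : Finset (Probability.LatticeModels.Site d)) (S : Finset (Plaq d)) :
    zdExpect (znRep 2) β Λ (fun U => ∏ p ∈ S, plaqSpin U p) =
      (∑ n ∈ (plaquettesIn Λ).powerset with IsClosed (S ∆ n), Real.tanh β ^ #n) /
        ∑ n ∈ (plaquettesIn Λ).powerset with IsClosed n, Real.tanh β ^ #n := by
  rw [zdExpect_eq_div_integral (znRep 2) (continuous_znRep 2) β Λ]
  have hden := integral_prod_plaqSpin_mul_exp β Λ (∅ : Finset (Plaq d))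
  simp only [Finset.prod_empty, one_mul] at hden
  have hden' : ∀ n : Finset (Plaq d), (∅ : Finset (Plaq d)) ∆ n = n := fun n =>
    (symmDiff_comm _ _).trans (symmDiff_bot n)
  simp_rw [hden'] at hden
  rw [integral_prod_plaqSpin_mul_exp β Λ S, hden]
  have hc : (0 : ℝ) < (Real.exp (-β) * Real.cosh β) ^ #(plaquettesIn Λ) :=
    pow_pos (mul_pos (Real.exp_pos _) (Real.cosh_pos β)) _
  rw [mul_div_mul_left _ _ hc.ne']

/-- The denominator of the surface representation is positive for `β ≥ 0` (the empty chain
contributes `1`). [cite: Aizenman2025, §9.2 (Z^{LGM} > 0)] -/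
theorem sum_closed_pos {β : ℝ} (hβ : 0 ≤ β) (P : Finset (Plaq d)) [DecidablePred (IsClosed (d := d))] :
    0 < ∑ n ∈ P.powerset with IsClosed n, Real.tanh β ^ #n := by
  have ht : 0 ≤ Real.tanh β := by
    rw [Real.tanh_eq_sinh_div_cosh]; exact div_nonneg (Real.sinh_nonneg_iff.2 hβ) (Real.cosh_pos β).le
  have h0 : (∅ : Finset (Plaq d)) ∈ P.powerset.filter (IsClosed (d := d)) :=
    Finset.mem_filter.2 ⟨Finset.empty_mem_powerset P, isClosed_empty⟩
  calc (0 : ℝ) < Real.tanh β ^ #(∅ : Finset (Plaq d)) := by simp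
    _ ≤ _ := Finset.single_le_sum (f := fun n => Real.tanh β ^ #n) (fun n _ => pow_nonneg ht _) h0

end Surface

/-! ### §5 The cube complex of a box: every closed `2`-chain bounds (`H₂ = 0`, free boundary) -/

section Cubes

/-- The third coordinate direction of `ℤ³`: for `i ≠ j`, `third i j` is the index `∉ {i, j}`
(in `Fin 3`, `i + j + k = 0`). [cite: Aizenman2025, §9.2 («plaquettes' dual objects in three dimensions are edges»)] -/
def third (i j : Fin 3) : Fin 3 := -(i + j)

/-- Combinatorics of the three coordinate directions (`Fin 3`). [cite: Aizenman2025, §9.2 («plaquettes' dual objects in three dimensions are edges»)] -/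
theorem third_ne_left : ∀ {i j : Fin 3}, i ≠ j → third i j ≠ i := by decide
/-- Combinatorics of the three coordinate directions (`Fin 3`). [cite: Aizenman2025, §9.2 («plaquettes' dual objects in three dimensions are edges»)] -/
theorem third_ne_right : ∀ {i j : Fin 3}, i ≠ j → third i j ≠ j := by decide
/-- Combinatorics of the three coordinate directions (`Fin 3`). [cite: Aizenman2025, §9.2 («plaquettes' dual objects in three dimensions are edges»)] -/
theorem eq_or_eq_or_eq_third (i j t : Fin 3) (hij : i ≠ j) : t = i ∨ t = j ∨ t = third i j := by
  revert i j t; decide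
/-- Combinatorics of the three coordinate directions (`Fin 3`). [cite: Aizenman2025, §9.2 («plaquettes' dual objects in three dimensions are edges»)] -/
theorem third_inj : ∀ {i j i' j' : Fin 3}, i < j → i' < j' → third i j = third i' j' → i = i' ∧ j = j' := by
  decide

/-- The pair complementary to `k`, concretely: `0 ↦ (1,2)`, `1 ↦ (0,2)`, `2 ↦ (0,1)`. [cite: Aizenman2025, §9.2] -/
def coPair : Fin 3 → Fin 3 × Fin 3 := ![(1, 2), (0, 2), (0, 1)]

/-- Combinatorics of the three coordinate directions (`Fin 3`). [cite: Aizenman2025, §9.2 («plaquettes' dual objects in three dimensions are edges»)] -/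
theorem coPair_lt : ∀ k : Fin 3, (coPair k).1 < (coPair k).2 := by decide
/-- Combinatorics of the three coordinate directions (`Fin 3`). [cite: Aizenman2025, §9.2 («plaquettes' dual objects in three dimensions are edges»)] -/
theorem third_coPair : ∀ k : Fin 3, third (coPair k).1 (coPair k).2 = k := by decide
/-- Combinatorics of the three coordinate directions (`Fin 3`). [cite: Aizenman2025, §9.2 («plaquettes' dual objects in three dimensions are edges»)] -/
theorem coPair_third : ∀ {i j : Fin 3}, i < j → coPair (third i j) = (i, j) := by decide

/-- Coordinates of `x ± eₖ`. [folklore] -/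
private theorem add_single_apply' (x : Probability.LatticeModels.Site 3) (k t : Fin 3) :
    (x + Pi.single k 1 : Probability.LatticeModels.Site 3) t = x t + if t = k then 1 else 0 := by
  simp [Pi.single_apply]
/-- Plumbing. [folklore] -/
private theorem sub_single_apply' (x : Probability.LatticeModels.Site 3) (k t : Fin 3) :
    (x - Pi.single k 1 : Probability.LatticeModels.Site 3) t = x t - if t = k then 1 else 0 := by
  simp [Pi.single_apply]

/-- **The gauge site box** `gaugeBox M = {-M, …, M+1}³` (written `ΛG M` in the docstrings below): the union of the unit cubes with lower corners in
`box 3 M` (Aizenman's «rectangular subgraph `Λ ⊂ ℤ³`», whose dual sites are those cubes).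
[cite: Aizenman2025, §9.2 (Thm 9.2 (1): rectangular subgraphs Λ ⊂ ℤ³ and their duals Λ*)] -/
def gaugeBox (M : ℕ) : Finset (Probability.LatticeModels.Site 3) :=
  Fintype.piFinset fun _ => Finset.Icc (-(M : ℤ)) (M + 1)

/-- Membership in the gauge site box. [cite: Aizenman2025, §9.2 (Thm 9.2: rectangular subgraphs Λ ⊂ ℤ³)] -/
@[simp] theorem mem_gaugeBox {M : ℕ} {x : Probability.LatticeModels.Site 3} :
    x ∈ gaugeBox M ↔ ∀ t, -(M : ℤ) ≤ x t ∧ x t ≤ M + 1 := by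
  simp [gaugeBox, Fintype.mem_piFinset]

variable {M : ℕ}

/-- **The faces of the cube complex**: `(w; i, j)` is a plaquette of `ΛG M` iff `i < j`, all
coordinates of `w` are `≥ -M`, `w_i, w_j ≤ M` and `w_k ≤ M + 1` (`k` the third direction), i.e. iff it
is a face of some unit cube with lower corner in `box 3 M`. [cite: Aizenman2025, §9.2 (the plaquettes of Λ and the dual bonds)] -/
theorem mem_faces_iff {w : Probability.LatticeModels.Site 3} {i j : Fin 3} :
    ((w, i, j) : Plaq 3) ∈ plaquettesIn (gaugeBox M) ↔
      i < j ∧ ∀ t, -(M : ℤ) ≤ w t ∧ w t + (if t = i ∨ t = j then 1 else 0) ≤ M + 1 := by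
  rw [Plaq.mem_plaquettesIn]
  simp only [mem_gaugeBox, Pi.add_apply, Pi.single_apply]
  constructor
  · rintro ⟨h0, hij, hi, hj, hij2⟩
    refine ⟨hij, fun t => ?_⟩
    have a := h0 t; have b := hi t; have c := hj t
    by_cases hti : t = i
    · subst hti; simp only [if_true, true_or] at b ⊢; omega
    · by_cases htj : t = j
      · subst htj; simp only [if_true, or_true] at c ⊢; omega
      · simp only [hti, htj, if_false, or_self] at b ⊢; omega
  · rintro ⟨hij, h⟩
    have hne : i ≠ j := hij.ne
    have key : ∀ t, -(M : ℤ) ≤ w t ∧ w t ≤ M + 1 ∧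
        (w t + if t = i then 1 else 0) ≤ M + 1 ∧ (w t + if t = j then 1 else 0) ≤ M + 1 ∧
        ((w t + if t = i then 1 else 0) + if t = j then 1 else 0) ≤ M + 1 := by
      intro t
      have h1 := (h t).1; have h2 := (h t).2
      by_cases hti : t = i
      · subst hti; simp only [if_true, true_or, if_neg hne] at h2 ⊢; omega
      · by_cases htj : t = j
        · subst htj; simp only [if_true, or_true, if_neg hti] at h2 ⊢; omega
        · simp only [hti, htj, if_false, or_self] at h2 ⊢; omega
    refine ⟨fun t => ⟨(key t).1, (key t).2.1⟩, hij, fun t => ⟨?_, (key t).2.2.1⟩, fun t => ⟨?_, (key t).2.2.2.1⟩,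
      fun t => ⟨?_, (key t).2.2.2.2⟩⟩
    · have := (key t).1; split_ifs <;> omega
    · have := (key t).1; split_ifs <;> omega
    · have := (key t).1; split_ifs <;> omega

/-- Faces have `i < j`. [cite: Aizenman2025, §9.2] -/
theorem lt_of_mem_faces {f : Plaq 3} (hf : f ∈ plaquettesIn (gaugeBox M)) : f.2.1 < f.2.2 :=
  (Plaq.mem_plaquettesIn.1 hf).2.1

/-- The lower face `(y; i, j)` of a cube `y ∈ box 3 M` is a face. [cite: Aizenman2025, §9.2] -/
theorem lowFace_mem_faces {y : Probability.LatticeModels.Site 3} (hy : y ∈ box 3 M) {i j : Fin 3} (hij : i < j) :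
    ((y, i, j) : Plaq 3) ∈ plaquettesIn (gaugeBox M) := by
  rw [mem_faces_iff]
  refine ⟨hij, fun t => ⟨(mem_box.1 hy t).1, ?_⟩⟩
  have := (mem_box.1 hy t).2
  split_ifs <;> omega

/-- The upper face `(y + eₖ; i, j)` of a cube `y ∈ box 3 M` is a face. [cite: Aizenman2025, §9.2] -/
theorem highFace_mem_faces {y : Probability.LatticeModels.Site 3} (hy : y ∈ box 3 M) {i j : Fin 3} (hij : i < j) :
    ((y + Pi.single (third i j) 1, i, j) : Plaq 3) ∈ plaquettesIn (gaugeBox M) := by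
  rw [mem_faces_iff]
  refine ⟨hij, fun t => ?_⟩
  have h1 := (mem_box.1 hy t).1; have h2 := (mem_box.1 hy t).2
  rw [add_single_apply']
  have hki : third i j ≠ i := third_ne_left hij.ne
  have hkj : third i j ≠ j := third_ne_right hij.ne
  constructor
  · split_ifs <;> omega
  · by_cases ht : t = third i j
    · subst ht; rw [if_pos rfl, if_neg (not_or.2 ⟨hki, hkj⟩)]; omega
    · rw [if_neg ht]; split_ifs <;> omega

/-- **The lower cube of a face**: the face `(w; i, j)` separates the cubes with lower corners
`w - eₖ` (below) and `w` (above), `k = third i j` — the two dual sites joined by the dual bond.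
[cite: Aizenman2025, §9.2 (proof of Thm 9.2: the pair of neighbouring dual sites u, v separated by the plaquette p)] -/
def lowCube (f : Plaq 3) : Probability.LatticeModels.Site 3 := f.1 - Pi.single (third f.2.1 f.2.2) 1

/-- A face of the complex has at least one of its two cubes in the box. [cite: Aizenman2025, §9.2] -/
theorem fst_mem_box_or_lowCube_mem_box {f : Plaq 3} (hf : f ∈ plaquettesIn (gaugeBox M)) :
    f.1 ∈ box 3 M ∨ lowCube f ∈ box 3 M := by
  obtain ⟨w, i, j⟩ := f
  obtain ⟨hij, h⟩ := mem_faces_iff.1 hf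
  by_cases hk : w (third i j) ≤ M
  · left; rw [mem_box]; intro t
    refine ⟨(h t).1, ?_⟩
    rcases eq_or_eq_or_eq_third i j t hij.ne with rfl | rfl | rfl
    · have := (h t).2; simp at this; omega
    · have := (h t).2; simp at this; omega
    · exact hk
  · right; rw [mem_box]; intro t
    have h1 := (h t).1; have h2 := (h t).2
    have hki : third i j ≠ i := third_ne_left hij.ne
    have hkj : third i j ≠ j := third_ne_right hij.ne
    show -(M : ℤ) ≤ (w - Pi.single (third i j) 1 : Probability.LatticeModels.Site 3) t ∧
      (w - Pi.single (third i j) 1 : Probability.LatticeModels.Site 3) t ≤ M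
    rw [sub_single_apply']
    by_cases ht : t = third i j
    · subst ht; rw [if_pos rfl]; rw [if_neg (not_or.2 ⟨hki, hkj⟩)] at h2; omega
    · rw [if_neg ht]; constructor
      · omega
      · split_ifs at h2 <;> omega

/-! #### Membership indicators in `ZMod 2` and the stars of the bonds -/

/-- The `ZMod 2` indicator of membership. [folklore] -/
def ind {α : Type*} [DecidableEq α] (Q : Finset α) (a : α) : ZMod 2 := if a ∈ Q then 1 else 0

/-- Plumbing. [folklore] -/
private theorem ind_of_mem {α : Type*} [DecidableEq α] {Q : Finset α} {a : α} (h : a ∈ Q) : ind Q a = 1 := if_pos h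
/-- Plumbing. [folklore] -/
private theorem ind_of_not_mem {α : Type*} [DecidableEq α] {Q : Finset α} {a : α} (h : a ∉ Q) : ind Q a = 0 := if_neg h

/-- Plumbing. [folklore] -/
private theorem zmod2_eq_zero_or_one (x : ZMod 2) : x = 0 ∨ x = 1 := by revert x; decide
/-- Plumbing. [folklore] -/
private theorem zmod2_add_self (x : ZMod 2) : x + x = 0 := by revert x; decide

/-- `∑_{f ∈ Q} [f = a] = [a ∈ Q]`. [folklore] -/
private theorem sum_ite_eq_ind {α : Type*} [DecidableEq α] (Q : Finset α) (a : α) :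
    (∑ f ∈ Q, if f = a then (1 : ZMod 2) else 0) = ind Q a := by
  rw [Finset.sum_ite_eq']; rfl

/-- **Star of a bond in direction `0`**: the slots of a plaquette `(w; i, j)`, `i < j`, equal to the
bond `(x, 0)` are counted by `[f = (x;0,1)] + [f = (x;0,2)] + [f = (x-e₁;0,1)] + [f = (x-e₂;0,2)]`
— the four plaquettes of `ℤ³` winding around the bond (Aizenman's «elementary loop of dual sites
which winds around an edge»). [cite: Aizenman2025, §9.2 (proof of Thm 9.2, elementary loops around edges)] -/
theorem sum_slot_eq_zero_dir (f : Plaq 3) (hf : f.2.1 < f.2.2) (x : Probability.LatticeModels.Site 3) :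
    (∑ s : Fin 4, if slot f s = (x, (0 : Fin 3)) then (1 : ZMod 2) else 0) =
      (if f = (x, 0, 1) then 1 else 0) + (if f = (x, 0, 2) then 1 else 0) +
        (if f = (x - Pi.single 1 1, 0, 1) then 1 else 0) + (if f = (x - Pi.single 2 1, 0, 2) then 1 else 0) := by
  obtain ⟨w, i, j⟩ := f
  simp only [Fin.sum_univ_four, slot_zero, slot_one, slot_two, slot_three, Prod.mk.injEq,
    ← eq_sub_iff_add_eq]
  fin_cases i <;> fin_cases j <;> simp_all (config := {decide := true})

/-- Star of a bond in direction `1`: the plaquettes `(x;1,2)`, `(x-e₀;0,1)`, `(x-e₂;1,2)`, `(x;0,1)`.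
[cite: Aizenman2025, §9.2 (elementary loops around edges)] -/
theorem sum_slot_eq_one_dir (f : Plaq 3) (hf : f.2.1 < f.2.2) (x : Probability.LatticeModels.Site 3) :
    (∑ s : Fin 4, if slot f s = (x, (1 : Fin 3)) then (1 : ZMod 2) else 0) =
      (if f = (x, 1, 2) then 1 else 0) + (if f = (x - Pi.single 0 1, 0, 1) then 1 else 0) +
        (if f = (x - Pi.single 2 1, 1, 2) then 1 else 0) + (if f = (x, 0, 1) then 1 else 0) := by
  obtain ⟨w, i, j⟩ := f
  simp only [Fin.sum_univ_four, slot_zero, slot_one, slot_two, slot_three, Prod.mk.injEq,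
    ← eq_sub_iff_add_eq]
  fin_cases i <;> fin_cases j <;> simp_all (config := {decide := true})

/-- Star of a bond in direction `2`: the plaquettes `(x-e₀;0,2)`, `(x-e₁;1,2)`, `(x;0,2)`, `(x;1,2)`.
[cite: Aizenman2025, §9.2 (elementary loops around edges)] -/
theorem sum_slot_eq_two_dir (f : Plaq 3) (hf : f.2.1 < f.2.2) (x : Probability.LatticeModels.Site 3) :
    (∑ s : Fin 4, if slot f s = (x, (2 : Fin 3)) then (1 : ZMod 2) else 0) =
      (if f = (x - Pi.single 0 1, 0, 2) then 1 else 0) + (if f = (x - Pi.single 1 1, 1, 2) then 1 else 0) +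
        (if f = (x, 0, 2) then 1 else 0) + (if f = (x, 1, 2) then 1 else 0) := by
  obtain ⟨w, i, j⟩ := f
  simp only [Fin.sum_univ_four, slot_zero, slot_one, slot_two, slot_three, Prod.mk.injEq,
    ← eq_sub_iff_add_eq]
  fin_cases i <;> fin_cases j <;> simp_all (config := {decide := true})

/-- **The boundary of a chain of genuine plaquettes at the bonds of each direction**, as a sum of
four membership indicators (the four plaquettes around the bond). [cite: Aizenman2025, §9.2 (eq. (48))] -/
theorem bdry_dir_zero {Q : Finset (Plaq 3)} (hQ : ∀ f ∈ Q, f.2.1 < f.2.2) (x : Probability.LatticeModels.Site 3) :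
    bdry Q (x, 0) = ind Q (x, 0, 1) + ind Q (x, 0, 2) + ind Q (x - Pi.single 1 1, 0, 1) +
      ind Q (x - Pi.single 2 1, 0, 2) := by
  classical
  unfold bdry
  rw [Finset.sum_congr rfl fun f hf => sum_slot_eq_zero_dir f (hQ f hf) x]
  simp only [Finset.sum_add_distrib, sum_ite_eq_ind]

/-- The boundary of a chain of genuine plaquettes at the bonds of this direction, as a sum of four membership indicators. [cite: Aizenman2025, §9.2 (eq. (48))] -/
theorem bdry_dir_one {Q : Finset (Plaq 3)} (hQ : ∀ f ∈ Q, f.2.1 < f.2.2) (x : Probability.LatticeModels.Site 3) :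
    bdry Q (x, 1) = ind Q (x, 1, 2) + ind Q (x - Pi.single 0 1, 0, 1) + ind Q (x - Pi.single 2 1, 1, 2) +
      ind Q (x, 0, 1) := by
  classical
  unfold bdry
  rw [Finset.sum_congr rfl fun f hf => sum_slot_eq_one_dir f (hQ f hf) x]
  simp only [Finset.sum_add_distrib, sum_ite_eq_ind]

/-- The boundary of a chain of genuine plaquettes at the bonds of this direction, as a sum of four membership indicators. [cite: Aizenman2025, §9.2 (eq. (48))] -/
theorem bdry_dir_two {Q : Finset (Plaq 3)} (hQ : ∀ f ∈ Q, f.2.1 < f.2.2) (x : Probability.LatticeModels.Site 3) :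
    bdry Q (x, 2) = ind Q (x - Pi.single 0 1, 0, 2) + ind Q (x - Pi.single 1 1, 1, 2) + ind Q (x, 0, 2) +
      ind Q (x, 1, 2) := by
  classical
  unfold bdry
  rw [Finset.sum_congr rfl fun f hf => sum_slot_eq_two_dir f (hQ f hf) x]
  simp only [Finset.sum_add_distrib, sum_ite_eq_ind]

/-! #### The coboundary of a set of cubes -/

/-- **The coboundary `δc` of a set `c` of cubes** (lower corners in `box 3 M`): the faces of the
complex separating a cube of `c` from a cube not in `c` (or from the exterior) — the Peierls
contours ∕ domain walls of the dual spin configuration `σ = -1` on `c`, `+1` elsewhere («`σ_u σ_v = (-1)^{n(p)}`»). [cite: Aizenman2025, §9.2 (proof of Thm 9.2, eq. (eq:curl))] -/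
def cobd (M : ℕ) (c : Finset (Probability.LatticeModels.Site 3)) : Finset (Plaq 3) :=
  (plaquettesIn (gaugeBox M)).filter fun f => (f.1 ∈ c ∧ lowCube f ∉ c) ∨ (f.1 ∉ c ∧ lowCube f ∈ c)

/-- The coboundary consists of faces of the complex. [cite: Aizenman2025, §9.2 (proof of Thm 9.2)] -/
theorem cobd_subset (c : Finset (Probability.LatticeModels.Site 3)) : cobd M c ⊆ plaquettesIn (gaugeBox M) :=
  Finset.filter_subset _ _

/-- **Membership in the coboundary, in `ZMod 2`**: for `c ⊆ box 3 M` and every genuine plaquette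
label `f` (`i < j`), `[f ∈ δc] = [f.1 ∈ c] + [lowCube f ∈ c]` (a face with a cube of `c` on either
side is automatically a face of the complex). [cite: Aizenman2025, §9.2 (eq. (eq:curl))] -/
theorem ind_cobd {c : Finset (Probability.LatticeModels.Site 3)} (hc : c ⊆ box 3 M) {f : Plaq 3} (hf : f.2.1 < f.2.2) :
    ind (cobd M c) f = ind c f.1 + ind c (lowCube f) := by
  have hP : f.1 ∈ c ∨ lowCube f ∈ c → f ∈ plaquettesIn (gaugeBox M) := by
    rintro (h | h)
    · obtain ⟨w, i, j⟩ := f; exact lowFace_mem_faces (hc h) hf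
    · obtain ⟨w, i, j⟩ := f
      have := highFace_mem_faces (hc h) hf
      simp only [lowCube, sub_add_cancel] at this; exact this
  have e10 : (1 : ZMod 2) = 1 + 0 := by decide
  have e01 : (1 : ZMod 2) = 0 + 1 := by decide
  have e11 : (0 : ZMod 2) = 1 + 1 := by decide
  have e00 : (0 : ZMod 2) = 0 + 0 := by decide
  unfold ind cobd
  by_cases h1 : f.1 ∈ c <;> by_cases h2 : lowCube f ∈ c
  · rw [if_neg (by simp [Finset.mem_filter, h1, h2]), if_pos h1, if_pos h2]; exact e11
  · rw [if_pos (Finset.mem_filter.2 ⟨hP (Or.inl h1), Or.inl ⟨h1, h2⟩⟩), if_pos h1, if_neg h2]; exact e10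
  · rw [if_pos (Finset.mem_filter.2 ⟨hP (Or.inr h2), Or.inr ⟨h1, h2⟩⟩), if_neg h1, if_pos h2]; exact e01
  · rw [if_neg (by simp [Finset.mem_filter, h1, h2]), if_neg h1, if_neg h2]; exact e00

/-- Sites have three coordinates: `x - eₖ - eₗ = x - eₗ - eₖ`. [folklore] -/
private theorem sub_sub_comm' (x : Probability.LatticeModels.Site 3) (k l : Fin 3) :
    x - Pi.single k (1 : ℤ) - Pi.single l 1 = x - Pi.single l 1 - Pi.single k 1 := sub_right_comm _ _ _

/-- **The coboundary of a set of cubes is a closed `2`-chain** (`∂δ = 0`: around every bond each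
cube contributes two faces). [cite: Aizenman2025, §9.2 (proof of Thm 9.2: consistency of (eq:curl) around every edge)] -/
theorem isClosed_cobd {c : Finset (Probability.LatticeModels.Site 3)} (hc : c ⊆ box 3 M) : IsClosed (cobd M c) := by
  have hQ : ∀ f ∈ cobd M c, f.2.1 < f.2.2 := fun f hf => lt_of_mem_faces (cobd_subset c hf)
  have key0 : ∀ (a b d e : ZMod 2), (a + b) + (a + d) + (d + e) + (b + e) = 0 := by decide
  have key1 : ∀ (a b d e : ZMod 2), (a + d) + (d + e) + (b + e) + (a + b) = 0 := by decide
  have key2 : ∀ (a d0 d1 e : ZMod 2), (d0 + e) + (d1 + e) + (a + d1) + (a + d0) = 0 := by decide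
  have h01 : (0 : Fin 3) < 1 := by decide
  have h02 : (0 : Fin 3) < 2 := by decide
  have h12 : (1 : Fin 3) < 2 := by decide
  have t01 : third 0 1 = 2 := by decide
  have t02 : third 0 2 = 1 := by decide
  have t12 : third 1 2 = 0 := by decide
  rintro ⟨x, m⟩
  fin_cases m
  · show bdry (cobd M c) (x, 0) = 0
    rw [bdry_dir_zero hQ x, ind_cobd hc h01, ind_cobd hc h02, ind_cobd hc h01, ind_cobd hc h02]
    simp only [lowCube, t01, t02]
    rw [sub_sub_comm' x 2 1]
    exact key0 _ _ _ _
  · show bdry (cobd M c) (x, 1) = 0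
    rw [bdry_dir_one hQ x, ind_cobd hc h12, ind_cobd hc h01, ind_cobd hc h12, ind_cobd hc h01]
    simp only [lowCube, t01, t12]
    rw [sub_sub_comm' x 2 0]
    exact key1 _ _ _ _
  · show bdry (cobd M c) (x, 2) = 0
    rw [bdry_dir_two hQ x, ind_cobd hc h02, ind_cobd hc h12, ind_cobd hc h02, ind_cobd hc h12]
    simp only [lowCube, t02, t12]
    rw [sub_sub_comm' x 1 0]
    exact key2 _ _ _ _

/-! #### Column parities («integrating along the vertical») -/

/-- **Column parity**: the number (mod 2) of horizontal faces `(w; 0, 1)` of `z` in the column of `y`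
at height `≤ y₂` — the parity of crossings of `z` by the vertical dual path from `-∞` to the cube
`y`, i.e. the dual spin at `y` constructed «through an iteration of (48) along a path». [cite: Aizenman2025, §9.2 (proof of Thm 9.2: constructing σ along a path)] -/
def colPar (z : Finset (Plaq 3)) (y : Probability.LatticeModels.Site 3) : ZMod 2 :=
  ∑ f ∈ z, if (f.2 = (0, 1) ∧ f.1 0 = y 0 ∧ f.1 1 = y 1) ∧ f.1 2 ≤ y 2 then 1 else 0

/-- One step up the column: `colPar z y = colPar z (y - e₂) + [ (y;0,1) ∈ z ]`. [cite: Aizenman2025, §9.2 (eq. (eq:curl) across one plaquette)] -/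
theorem colPar_eq_colPar_sub_add (z : Finset (Plaq 3)) (y : Probability.LatticeModels.Site 3) :
    colPar z y = colPar z (y - Pi.single 2 1) + ind z (y, 0, 1) := by
  classical
  have step : ∀ a b : ℤ, (if a ≤ b then (1 : ZMod 2) else 0) =
      (if a ≤ b - 1 then (1 : ZMod 2) else 0) + if a = b then 1 else 0 := by
    intro a b
    by_cases h1 : a ≤ b - 1
    · rw [if_pos (by omega), if_pos h1, if_neg (by omega), add_zero]
    · by_cases h2 : a = b
      · rw [if_pos (by omega), if_neg h1, if_pos h2, zero_add]
      · rw [if_neg (by omega), if_neg h1, if_neg h2, add_zero]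
  unfold colPar
  rw [← sum_ite_eq_ind, ← Finset.sum_add_distrib]
  refine Finset.sum_congr rfl fun f _ => ?_
  obtain ⟨w, i, j⟩ := f
  have heq : (((w, i, j) : Plaq 3) = (y, 0, 1)) ↔
      (((i, j) = ((0 : Fin 3), (1 : Fin 3)) ∧ w 0 = y 0 ∧ w 1 = y 1) ∧ w 2 = y 2) := by
    constructor
    · intro h; cases h; exact ⟨⟨rfl, rfl, rfl⟩, rfl⟩
    · rintro ⟨⟨hij, h0, h1⟩, h2⟩
      simp only [Prod.mk.injEq] at hij
      obtain ⟨rfl, rfl⟩ := hij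
      have : w = y := by funext t; fin_cases t <;> assumption
      subst this; rfl
  have e0 : (y - Pi.single 2 1 : Probability.LatticeModels.Site 3) 0 = y 0 := by
    rw [sub_single_apply', if_neg (by decide), sub_zero]
  have e1 : (y - Pi.single 2 1 : Probability.LatticeModels.Site 3) 1 = y 1 := by
    rw [sub_single_apply', if_neg (by decide), sub_zero]
  have e2 : (y - Pi.single 2 1 : Probability.LatticeModels.Site 3) 2 = y 2 - 1 := by
    rw [sub_single_apply', if_pos rfl]
  simp only [e0, e1, e2]
  rw [show (if ((w, i, j) : Plaq 3) = (y, 0, 1) then (1 : ZMod 2) else 0) =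
      if (((i, j) = ((0 : Fin 3), (1 : Fin 3)) ∧ w 0 = y 0 ∧ w 1 = y 1) ∧ w 2 = y 2) then 1 else 0 by
    simp only [heq]]
  by_cases hA : ((i, j) = ((0 : Fin 3), (1 : Fin 3)) ∧ w 0 = y 0 ∧ w 1 = y 1)
  · simp only [hA, true_and]
    exact step _ _
  · simp only [hA, false_and, if_false, add_zero]

/-- A shift-invariant `ZMod 2`-valued function on `ℤ³` vanishing far below vanishes identically.
[folklore] -/
private theorem eq_zero_of_shift_invariant (k : Fin 3) {D : Probability.LatticeModels.Site 3 → ZMod 2}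
    (hrec : ∀ w, D w = D (w - Pi.single k 1)) {b : ℤ} (hvan : ∀ w, w k < b → D w = 0) (w : Probability.LatticeModels.Site 3) :
    D w = 0 := by
  have hiter : ∀ n : ℕ, D w = D (w - (n : ℤ) • Pi.single k 1) := by
    intro n
    induction n with
    | zero => simp
    | succ n ih =>
      rw [ih, hrec]; congr 1; push_cast; rw [add_smul, one_smul, sub_sub]
  obtain ⟨n, hn⟩ : ∃ n : ℕ, w k - n < b := ⟨(w k - b + 1).toNat, by omega⟩
  rw [hiter n]
  apply hvan
  simpa [Pi.smul_apply, Pi.single_apply] using hn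

variable {z : Finset (Plaq 3)}

/-- Faces far below the box do not belong to a chain of faces. [folklore] -/
private theorem ind_eq_zero_of_lt (hz : z ⊆ plaquettesIn (gaugeBox M)) {w : Probability.LatticeModels.Site 3} {i j : Fin 3}
    {t : Fin 3} (hw : w t < -(M : ℤ)) : ind z (w, i, j) = 0 := by
  apply ind_of_not_mem
  intro h
  have := ((mem_faces_iff.1 (hz h)).2 t).1
  omega

/-- A face `(w; i, j)` with `w_k > M+1` for the third direction... more generally with some
coordinate pushing a corner above `M + 1` is not a face. [folklore] -/
private theorem ind_eq_zero_of_gt (hz : z ⊆ plaquettesIn (gaugeBox M)) {w : Probability.LatticeModels.Site 3} {i j : Fin 3}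
    {t : Fin 3} (hw : (M : ℤ) + 1 < w t + if t = i ∨ t = j then 1 else 0) : ind z (w, i, j) = 0 := by
  apply ind_of_not_mem
  intro h
  have := ((mem_faces_iff.1 (hz h)).2 t).2
  omega

/-- Column parities vanish below the box. [folklore] -/
private theorem colPar_eq_zero_of_lt (hz : z ⊆ plaquettesIn (gaugeBox M)) {y : Probability.LatticeModels.Site 3}
    (hy : y 2 < -(M : ℤ)) : colPar z y = 0 := by
  unfold colPar
  refine Finset.sum_eq_zero fun f hf => ?_
  rw [if_neg]
  rintro ⟨-, h3⟩
  have := ((mem_faces_iff.1 (hz hf)).2 2).1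
  omega

/-- Column parities vanish outside the footprint of the box. [folklore] -/
private theorem colPar_eq_zero_of_footprint (hz : z ⊆ plaquettesIn (gaugeBox M)) {y : Probability.LatticeModels.Site 3}
    (hy : y 0 < -(M : ℤ) ∨ (M : ℤ) < y 0 ∨ y 1 < -(M : ℤ) ∨ (M : ℤ) < y 1) : colPar z y = 0 := by
  unfold colPar
  refine Finset.sum_eq_zero fun f hf => ?_
  rw [if_neg]
  rintro ⟨⟨hij, h0, h1⟩, -⟩
  obtain ⟨w, i, j⟩ := f
  simp only [Prod.mk.injEq] at hij
  obtain ⟨rfl, rfl⟩ := hij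
  have a := (mem_faces_iff.1 (hz hf)).2 0
  have b := (mem_faces_iff.1 (hz hf)).2 1
  simp at a b h0 h1
  omega

/-- Above the box the column parity is the total column parity. [folklore] -/
private theorem colPar_eq_colPar_top (hz : z ⊆ plaquettesIn (gaugeBox M)) (y : Probability.LatticeModels.Site 3)
    (hy : (M : ℤ) + 1 ≤ y 2) : colPar z y = colPar z (Function.update y 2 (M + 1)) := by
  unfold colPar
  refine Finset.sum_congr rfl fun f hf => ?_
  simp only [Function.update_self, Function.update_of_ne (show (0 : Fin 3) ≠ 2 by decide),
    Function.update_of_ne (show (1 : Fin 3) ≠ 2 by decide)]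
  obtain ⟨w, i, j⟩ := f
  have := ((mem_faces_iff.1 (hz hf)).2 2).2
  have h3 : w 2 ≤ y 2 ↔ w 2 ≤ (M : ℤ) + 1 := by constructor <;> intro <;> (split_ifs at this <;> omega)
  simp only [h3]

/-- **The vertical telescoping identity** (closed `z`): for every `w`,
`[(w;0,2) ∈ z] = colPar z w + colPar z (w - e₁)` — closedness at the bonds `(·, 0)` of the column,
summed from `-∞`. [cite: Aizenman2025, §9.2 (proof of Thm 9.2: consistency of the path construction, contractible loops)] -/
theorem ind_vert02_eq (hz : z ⊆ plaquettesIn (gaugeBox M)) (hcl : IsClosed z) (w : Probability.LatticeModels.Site 3) :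
    ind z (w, 0, 2) = colPar z w + colPar z (w - Pi.single 1 1) := by
  have hQ : ∀ f ∈ z, f.2.1 < f.2.2 := fun f hf => lt_of_mem_faces (hz hf)
  set D : Probability.LatticeModels.Site 3 → ZMod 2 := fun w => ind z (w, 0, 2) + colPar z w + colPar z (w - Pi.single 1 1) with hD
  suffices h : D w = 0 by
    have e3 : ∀ a b c : ZMod 2, a + b + c = 0 → a = b + c := by decide
    exact e3 _ _ _ h
  refine eq_zero_of_shift_invariant 2 (fun w => ?_) (b := -(M : ℤ)) (fun w hw => ?_) w
  · -- the recursion `D w = D (w - e₂)` is closedness at the bond `(w, 0)`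
    have hc := hcl (w, 0)
    rw [bdry_dir_zero hQ w] at hc
    simp only [hD]
    rw [colPar_eq_colPar_sub_add z w, colPar_eq_colPar_sub_add z (w - Pi.single 1 1), sub_sub_comm' w 1 2]
    -- `hc : [H w] + [V w] + [H (w-e₁)] + [V (w-e₂)] = 0`
    have e1 : ∀ (Hw Vw Hw1 Vw2 c c1 : ZMod 2), Hw + Vw + Hw1 + Vw2 = 0 →
        Vw + (c + Hw) + (c1 + Hw1) = Vw2 + c + c1 := by decide
    exact e1 _ _ _ _ _ _ hc
  · simp only [hD]
    rw [ind_eq_zero_of_lt hz (t := 2) hw, colPar_eq_zero_of_lt hz hw,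
      colPar_eq_zero_of_lt hz (by simpa [sub_single_apply'] using hw), add_zero, add_zero]

/-- The telescoping identity for the faces `(w; 1, 2)`: `[(w;1,2) ∈ z] = colPar z w + colPar z (w - e₀)`
(closedness at the bonds `(·, 1)`). [cite: Aizenman2025, §9.2 (proof of Thm 9.2)] -/
theorem ind_vert12_eq (hz : z ⊆ plaquettesIn (gaugeBox M)) (hcl : IsClosed z) (w : Probability.LatticeModels.Site 3) :
    ind z (w, 1, 2) = colPar z w + colPar z (w - Pi.single 0 1) := by
  have hQ : ∀ f ∈ z, f.2.1 < f.2.2 := fun f hf => lt_of_mem_faces (hz hf)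
  set D : Probability.LatticeModels.Site 3 → ZMod 2 := fun w => ind z (w, 1, 2) + colPar z w + colPar z (w - Pi.single 0 1) with hD
  suffices h : D w = 0 by
    have e3 : ∀ a b c : ZMod 2, a + b + c = 0 → a = b + c := by decide
    exact e3 _ _ _ h
  refine eq_zero_of_shift_invariant 2 (fun w => ?_) (b := -(M : ℤ)) (fun w hw => ?_) w
  · have hc := hcl (w, 1)
    rw [bdry_dir_one hQ w] at hc
    simp only [hD]
    rw [colPar_eq_colPar_sub_add z w, colPar_eq_colPar_sub_add z (w - Pi.single 0 1), sub_sub_comm' w 0 2]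
    have e1 : ∀ (Vw Hw0 Vw2 Hw c c0 : ZMod 2), Vw + Hw0 + Vw2 + Hw = 0 →
        Vw + (c + Hw) + (c0 + Hw0) = Vw2 + c + c0 := by decide
    exact e1 _ _ _ _ _ _ hc
  · simp only [hD]
    rw [ind_eq_zero_of_lt hz (t := 2) hw, colPar_eq_zero_of_lt hz hw,
      colPar_eq_zero_of_lt hz (by simpa [sub_single_apply'] using hw), add_zero, add_zero]

/-- **Total column parities of a closed chain vanish** (a vertical line meets a closed surface an
even number of times): at height `M + 1` the faces `(w;0,2)` are absent, so the telescoping identity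
propagates `colPar` along `e₁` from outside the footprint. [cite: Aizenman2025, §9.2 (proof of Thm 9.2)] -/
theorem colPar_top_eq_zero (hz : z ⊆ plaquettesIn (gaugeBox M)) (hcl : IsClosed z) (w : Probability.LatticeModels.Site 3)
    (hw : w 2 = (M : ℤ) + 1) : colPar z w = 0 := by
  set D : Probability.LatticeModels.Site 3 → ZMod 2 := fun y => colPar z (Function.update y 2 (M + 1)) with hD
  have hwD : colPar z w = D w := by
    simp only [hD]; congr 1; ext t; by_cases ht : t = 2 <;> simp [ht, hw]
  rw [hwD]
  refine eq_zero_of_shift_invariant 1 (fun y => ?_) (b := -(M : ℤ)) (fun y hy => ?_) w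
  · simp only [hD]
    set y' := Function.update y 2 ((M : ℤ) + 1) with hy'
    have h := ind_vert02_eq hz hcl y'
    rw [ind_eq_zero_of_gt hz (t := 2) (by simp [hy']) ] at h
    have e1 : ∀ a b : ZMod 2, 0 = a + b → a = b := by decide
    have h2 := e1 _ _ h
    rw [h2]; congr 1; ext t
    by_cases ht : t = 2
    · subst ht; simp [hy']
    · simp [hy', ht]
  · simp only [hD]
    apply colPar_eq_zero_of_footprint hz
    right; right; left; simpa [Function.update_of_ne (show (1 : Fin 3) ≠ 2 by decide)] using hy

/-- The column parity of a closed chain of faces is `1` only at cubes of the box (the support of the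
dual spin flip is inside `Λ*`). [cite: Aizenman2025, §9.2 (proof of Thm 9.2: σ is determined by 𝐧 inside Λ*)] -/
theorem mem_box_of_colPar_eq_one (hz : z ⊆ plaquettesIn (gaugeBox M)) (hcl : IsClosed z) {y : Probability.LatticeModels.Site 3}
    (hy : colPar z y = 1) : y ∈ box 3 M := by
  have hfp : ¬ (y 0 < -(M : ℤ) ∨ (M : ℤ) < y 0 ∨ y 1 < -(M : ℤ) ∨ (M : ℤ) < y 1) := fun h' => by
    rw [colPar_eq_zero_of_footprint hz h'] at hy; exact zero_ne_one hy
  have hlow : ¬ y 2 < -(M : ℤ) := fun h' => by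
    rw [colPar_eq_zero_of_lt hz h'] at hy; exact zero_ne_one hy
  have hhigh : ¬ (M : ℤ) + 1 ≤ y 2 := fun h' => by
    rw [colPar_eq_colPar_top hz y h', colPar_top_eq_zero hz hcl _ (by simp)] at hy
    exact zero_ne_one hy
  rw [mem_box]
  intro t
  fin_cases t <;> simp <;> omega

/-- **The filling of a closed chain**: the cubes of odd column parity. [cite: Aizenman2025, §9.2 (proof of Thm 9.2: the spin configuration σ determined by 𝐧)] -/
def sweep (M : ℕ) (z : Finset (Plaq 3)) : Finset (Probability.LatticeModels.Site 3) :=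
  (box 3 M).filter fun y => colPar z y = 1

/-- The filling consists of cubes of the box. [cite: Aizenman2025, §9.2 (proof of Thm 9.2)] -/
theorem sweep_subset (z : Finset (Plaq 3)) : sweep M z ⊆ box 3 M := Finset.filter_subset _ _

/-- The filling consists of cubes of the box. [cite: Aizenman2025, §9.2 (proof of Thm 9.2)] -/
theorem mem_sweep {z : Finset (Plaq 3)} {y : Probability.LatticeModels.Site 3} :
    y ∈ sweep M z ↔ y ∈ box 3 M ∧ colPar z y = 1 := Finset.mem_filter

/-- For a closed chain of faces, `[y ∈ sweep z] = colPar z y` for EVERY `y ∈ ℤ³`. [cite: Aizenman2025, §9.2 (proof of Thm 9.2)] -/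
theorem ind_sweep (hz : z ⊆ plaquettesIn (gaugeBox M)) (hcl : IsClosed z) (y : Probability.LatticeModels.Site 3) :
    ind (sweep M z) y = colPar z y := by
  unfold ind
  rcases zmod2_eq_zero_or_one (colPar z y) with h | h
  · rw [h, if_neg]
    intro hm
    have := (mem_sweep.1 hm).2
    rw [h] at this; exact zero_ne_one this
  · rw [h, if_pos (mem_sweep.2 ⟨mem_box_of_colPar_eq_one hz hcl h, h⟩)]

/-- **Existence (`H₂ = 0`): every closed chain of faces of the cube complex of the box is the
coboundary of its filling.** [cite: Aizenman2025, §9.2 (proof of Thm 9.2: «any loop of the dual graph can be presented as a symmetric difference of elementary loops», free boundary conditions)] -/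
theorem cobd_sweep (hz : z ⊆ plaquettesIn (gaugeBox M)) (hcl : IsClosed z) : cobd M (sweep M z) = z := by
  have hsub := sweep_subset (M := M) z
  ext f
  suffices h : ind (cobd M (sweep M z)) f = ind z f by
    unfold ind at h
    by_cases h1 : f ∈ cobd M (sweep M z) <;> by_cases h2 : f ∈ z <;> simp_all
  by_cases hf : f.2.1 < f.2.2
  swap
  · rw [ind_of_not_mem (fun h => hf (lt_of_mem_faces (cobd_subset _ h))),
      ind_of_not_mem (fun h => hf (lt_of_mem_faces (hz h)))]
  rw [ind_cobd hsub hf, ind_sweep hz hcl, ind_sweep hz hcl]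
  obtain ⟨w, i, j⟩ := f
  simp only [lowCube]
  change i < j at hf
  -- the three kinds of faces
  have hcases : (i, j) = ((0 : Fin 3), (1 : Fin 3)) ∨ (i, j) = ((0 : Fin 3), (2 : Fin 3)) ∨
      (i, j) = ((1 : Fin 3), (2 : Fin 3)) := by
    revert hf; revert i j; decide
  rcases hcases with h | h | h <;> obtain ⟨rfl, rfl⟩ := Prod.mk.injEq _ _ _ _ ▸ h
  · rw [show third 0 1 = 2 by decide, colPar_eq_colPar_sub_add z w]
    have e1 : ∀ a b : ZMod 2, a + b + a = b := by decide
    exact e1 _ _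
  · rw [show third 0 2 = 1 by decide, ind_vert02_eq hz hcl w]
  · rw [show third 1 2 = 0 by decide, ind_vert12_eq hz hcl w]

/-- **Uniqueness: a set of cubes of the box is recovered from its coboundary by column parities**
(the dual spin configuration is determined by its domain walls and the `+` exterior — no global
flip ambiguity with the wired exterior). [cite: Aizenman2025, §9.2 (proof of Thm 9.2: uniqueness of σ given its value at one dual site)] -/
theorem colPar_cobd {c : Finset (Probability.LatticeModels.Site 3)} (hc : c ⊆ box 3 M) (y : Probability.LatticeModels.Site 3) :
    colPar (cobd M c) y = ind c y := by
  set D : Probability.LatticeModels.Site 3 → ZMod 2 := fun y => colPar (cobd M c) y + ind c y with hD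
  suffices h : D y = 0 by
    have e1 : ∀ a b : ZMod 2, a + b = 0 → a = b := by decide
    exact e1 _ _ h
  refine eq_zero_of_shift_invariant 2 (fun w => ?_) (b := -(M : ℤ)) (fun w hw => ?_) y
  · simp only [hD]
    rw [colPar_eq_colPar_sub_add (cobd M c) w, ind_cobd hc (show (0 : Fin 3) < 1 by decide)]
    simp only [lowCube, show third 0 1 = 2 by decide]
    have e1 : ∀ a b d : ZMod 2, a + (b + d) + b = a + d := by decide
    exact e1 _ _ _
  · simp only [hD]
    rw [colPar_eq_zero_of_lt (cobd_subset c) hw, ind_of_not_mem, add_zero]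
    intro h; have := (mem_box.1 (hc h) 2).1; omega

/-- The filling of the coboundary of `c ⊆ box 3 M` is `c`. [cite: Aizenman2025, §9.2 (proof of Thm 9.2)] -/
theorem sweep_cobd {c : Finset (Probability.LatticeModels.Site 3)} (hc : c ⊆ box 3 M) : sweep M (cobd M c) = c := by
  ext y
  rw [mem_sweep, colPar_cobd hc y]
  unfold ind
  constructor
  · rintro ⟨-, h⟩; by_contra hy; rw [if_neg hy] at h; exact zero_ne_one h
  · intro hy; exact ⟨hc hy, by rw [if_pos hy]⟩

open scoped Classical in
/-- **The cube–surface bijection** (Aizenman: divergence-free currents with free boundary conditions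
↔ dual spin configurations with the exterior spin fixed): `c ↦ δc` is a bijection from the subsets
of `box 3 M` onto the closed chains of faces of `ΛG M`; hence sums over closed chains are sums over
sets of cubes. [cite: Aizenman2025, §9.2 (proof of Thm 9.2 (1): the partial sums over 𝐧 producing a given σ)] -/
theorem sum_closed_eq_sum_powerset_box (g : Finset (Plaq 3) → ℝ) :
    ∑ z ∈ (plaquettesIn (gaugeBox M)).powerset with IsClosed z, g z = ∑ c ∈ (box 3 M).powerset, g (cobd M c) := by
  symm
  refine Finset.sum_nbij' (cobd M) (sweep M) (fun c hc => ?_) (fun z hz => ?_) (fun c hc => ?_)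
    (fun z hz => ?_) (fun c _ => rfl)
  · rw [Finset.mem_powerset] at hc
    exact Finset.mem_filter.2 ⟨Finset.mem_powerset.2 (cobd_subset c), isClosed_cobd hc⟩
  · exact Finset.mem_powerset.2 (sweep_subset z)
  · exact sweep_cobd (Finset.mem_powerset.1 hc)
  · obtain ⟨hz1, hz2⟩ := Finset.mem_filter.1 hz
    exact cobd_sweep (Finset.mem_powerset.1 hz1) hz2

end Cubes

/-! ### §6 The dual Ising model: faces ↔ bonds of `ℰ^b_{box}`, domain walls ↔ Boltzmann weights -/

section Dual

variable {M : ℕ}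

/-- **The dual bond of a face**: the face `(z; i, j)` is crossed by the dual bond joining the cubes
`z - eₖ` and `z` (`k` the third direction); with cubes labelled by their lower corners this is a
nearest-neighbour bond of `ℤ³ ≅ (ℤ³)*`. [cite: Aizenman2025, §9.2 («plaquettes' dual objects in three dimensions are edges»)] -/
def dualEdge (f : Plaq 3) : Sym2 (Probability.LatticeModels.Site 3) := s(lowCube f, f.1)

/-- The upper cube of a face is its lower cube shifted by `eₖ`. [cite: Aizenman2025, §9.2 (the pair of dual sites separated by a plaquette)] -/
theorem lowCube_add (f : Plaq 3) : lowCube f + Pi.single (third f.2.1 f.2.2) 1 = f.1 := by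
  rw [lowCube, sub_add_cancel]

/-- The two cubes of a face are nearest neighbours. [cite: Aizenman2025, §9.2] -/
theorem adj_lowCube_fst (f : Plaq 3) : (zdGraph 3).Adj (lowCube f) f.1 :=
  (zdGraph_adj_iff _ _).2 ⟨third f.2.1 f.2.2, Or.inl (lowCube_add f).symm⟩

/-- The dual bond of a face of the complex is a bond of `ℰ^b_{box 3 M}` (it touches the box).
[cite: Aizenman2025, §9.2 (Thm 9.2 (1): |ℰ*| = number of plaquettes of Λ)] -/
theorem dualEdge_mem_edgesTouching {f : Plaq 3} (hf : f ∈ plaquettesIn (gaugeBox M)) :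
    dualEdge f ∈ edgesTouching (zdGraph 3) (box 3 M) := by
  rw [mem_edgesTouching_iff]
  refine ⟨(SimpleGraph.mem_edgeSet _).2 (adj_lowCube_fst f), ?_⟩
  rcases fst_mem_box_or_lowCube_mem_box hf with h | h
  · exact ⟨f.1, h, Sym2.mem_mk_right _ _⟩
  · exact ⟨lowCube f, h, Sym2.mem_mk_left _ _⟩

/-- `eₖ ≠ 0` and `eₖ + eₗ ≠ 0` in `ℤ³`. [folklore] -/
private theorem single_add_single_ne_zero (k l : Fin 3) :
    (Pi.single k 1 + Pi.single l 1 : Probability.LatticeModels.Site 3) ≠ 0 := by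
  intro h
  have := congrFun h k
  simp only [Pi.add_apply, Pi.single_apply, if_true, Pi.zero_apply] at this
  split_ifs at this <;> omega

/-- **`dualEdge` is injective on genuine plaquettes** (a bond determines its two cubes and hence the
face between them). [cite: Aizenman2025, §9.2] -/
theorem dualEdge_injOn :
    Set.InjOn dualEdge {f : Plaq 3 | f.2.1 < f.2.2} := by
  rintro ⟨w, i, j⟩ hf ⟨w', i', j'⟩ hf' h
  simp only [Set.mem_setOf_eq] at hf hf'
  rw [dualEdge, dualEdge, Sym2.eq_iff] at h
  simp only [lowCube] at h
  rcases h with ⟨h1, h2⟩ | ⟨h1, h2⟩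
  · -- same upper cube and same lower cube: same third direction
    subst h2
    have hk : third i j = third i' j' := by
      have h3 : (Pi.single (third i j) (1 : ℤ) : Probability.LatticeModels.Site 3) = Pi.single (third i' j') 1 :=
        sub_right_injective h1
      by_contra hne
      have := congrFun h3 (third i j)
      rw [Pi.single_eq_same, Pi.single_eq_of_ne hne] at this
      exact one_ne_zero this
    obtain ⟨rfl, rfl⟩ := third_inj hf hf' hk
    rfl
  · -- `w - eₖ = w'` and `w = w' - e_{k'}`: impossible
    exfalso
    have : (Pi.single (third i j) 1 + Pi.single (third i' j') 1 : Probability.LatticeModels.Site 3) = 0 := by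
      have e := h1; rw [h2] at e
      -- e : w' - e_{k'} - e_k = w'
      have : w' - (Pi.single (third i' j') 1 + Pi.single (third i j) 1) = w' - 0 := by
        rw [sub_zero, ← sub_sub]; exact e
      have := sub_right_injective this
      rwa [add_comm] at this
    exact single_add_single_ne_zero _ _ this

/-- **Every bond of `ℰ^b_{box 3 M}` is the dual of a face of the complex** (the dual graph `Λ*` of
the rectangular box together with its bonds to the exterior). [cite: Aizenman2025, §9.2 (Thm 9.2: Λ* is the graph dual of Λ)] -/
theorem exists_dualEdge_eq {e : Sym2 (Probability.LatticeModels.Site 3)}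
    (he : e ∈ edgesTouching (zdGraph 3) (box 3 M)) :
    ∃ f ∈ plaquettesIn (gaugeBox M), dualEdge f = e := by
  induction e using Sym2.ind with
  | _ a b =>
    rw [mem_edgesTouching_iff, SimpleGraph.mem_edgeSet] at he
    obtain ⟨hadj, x, hx, hxe⟩ := he
    -- orient the bond upwards: `e = s(v - eₖ, v)`
    obtain ⟨k, v, hv, he⟩ : ∃ (k : Fin 3) (v : Probability.LatticeModels.Site 3),
        (v ∈ box 3 M ∨ v - Pi.single k 1 ∈ box 3 M) ∧ s(a, b) = s(v - Pi.single k 1, v) := by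
      obtain ⟨k, hk | hk⟩ := (zdGraph_adj_iff a b).1 hadj
      · refine ⟨k, b, ?_, ?_⟩
        · have ha : a = b - Pi.single k 1 := by rw [hk, add_sub_cancel_right]
          rcases Sym2.mem_iff.1 hxe with rfl | rfl
          · right; rwa [← ha]
          · left; exact hx
        · rw [hk, add_sub_cancel_right]
      · refine ⟨k, a, ?_, ?_⟩
        · have hb : b = a - Pi.single k 1 := by rw [hk, add_sub_cancel_right]
          rcases Sym2.mem_iff.1 hxe with rfl | rfl
          · left; exact hx
          · right; rwa [← hb]
        · rw [hk, add_sub_cancel_right, Sym2.eq_swap]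
    refine ⟨(v, (coPair k).1, (coPair k).2), ?_, ?_⟩
    · rw [mem_faces_iff]
      refine ⟨coPair_lt k, fun t => ?_⟩
      have hkt' : ∀ k : Fin 3, ¬ (k = (coPair k).1 ∨ k = (coPair k).2) := by decide
      have hkt := hkt' k
      rcases hv with hv | hv
      · have h1 := (mem_box.1 hv t).1; have h2 := (mem_box.1 hv t).2
        constructor <;> [skip; split_ifs] <;> omega
      · have h1 := (mem_box.1 hv t).1; have h2 := (mem_box.1 hv t).2
        rw [sub_single_apply'] at h1 h2
        by_cases ht : t = k
        · subst ht; rw [if_pos rfl] at h1 h2; rw [if_neg hkt]; omega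
        · rw [if_neg ht] at h1 h2; split_ifs <;> omega
    · rw [he, dualEdge, lowCube, third_coPair]

/-- The dual bonds of the faces are exactly the bonds of the plus-boundary Ising box.
[cite: Aizenman2025, §9.2 (Thm 9.2 (1))] -/
theorem image_dualEdge_faces :
    (plaquettesIn (gaugeBox M)).image dualEdge = edgesTouching (zdGraph 3) (box 3 M) := by
  ext e
  rw [Finset.mem_image]
  constructor
  · rintro ⟨f, hf, rfl⟩; exact dualEdge_mem_edgesTouching hf
  · exact exists_dualEdge_eq

/-- **Sums over the bonds of the plus-boundary Ising box are sums over the faces of the gauge box.**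
[cite: Aizenman2025, §9.2 (Thm 9.2 (1): the product over ℰ* of cosh/sinh factors)] -/
theorem sum_edgesTouching_eq_sum_faces (g : Sym2 (Probability.LatticeModels.Site 3) → ℝ) :
    ∑ e ∈ edgesTouching (zdGraph 3) (box 3 M), g e = ∑ f ∈ plaquettesIn (gaugeBox M), g (dualEdge f) := by
  rw [← image_dualEdge_faces, Finset.sum_image]
  exact fun f hf f' hf' h => dualEdge_injOn (lt_of_mem_faces hf) (lt_of_mem_faces hf') h

/-! #### Dual spin configurations -/

/-- The dual spin configuration of a set `c` of cubes of the box: `-1` on `c`, `+1` elsewhere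
(inside the box; outside, the plus boundary condition). [cite: Aizenman2025, §9.2 (proof of Thm 9.2: the spin configuration σ : 𝒱* → {-1,1})] -/
def spinsOf (M : ℕ) (c : Finset (Probability.LatticeModels.Site 3)) : ↥(box 3 M) → ℤˣ :=
  fun y => if (y : Probability.LatticeModels.Site 3) ∈ c then -1 else 1

/-- The glued configuration: `σ_y = -1` iff `y ∈ c` (for `c ⊆ box`, at every `y ∈ ℤ³`).
[cite: Aizenman2025, §9.2 (proof of Thm 9.2)] -/
theorem spinAt_glue_spinsOf {c : Finset (Probability.LatticeModels.Site 3)} (hc : c ⊆ box 3 M)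
    (y : Probability.LatticeModels.Site 3) :
    spinAt y (glue (box 3 M) (spinsOf M c) .plus) = if y ∈ c then -1 else 1 := by
  unfold spinAt
  by_cases hy : y ∈ box 3 M
  · rw [glue_apply_of_mem _ _ _ hy, spinsOf]
    by_cases hyc : y ∈ c
    · rw [if_pos hyc, if_pos hyc]; simp
    · rw [if_neg hyc, if_neg hyc]; simp
  · rw [glue_apply_of_notMem _ _ _ hy, if_neg (fun h => hy (hc h))]
    simp [BoundaryCondition.plus]

/-- **Domain walls**: across the dual bond of a face, `σ_u σ_v = -1` iff exactly one of the two
cubes lies in `c`, i.e. iff the face is in the coboundary `δc` («`σ_u σ_v = (-1)^{n(p)}`»).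
[cite: Aizenman2025, §9.2 (proof of Thm 9.2, eq. (eq:curl))] -/
theorem bondSpin_dualEdge {c : Finset (Probability.LatticeModels.Site 3)} (hc : c ⊆ box 3 M) (f : Plaq 3) :
    bondSpin (glue (box 3 M) (spinsOf M c) .plus) (dualEdge f) =
      if (f.1 ∈ c ∧ lowCube f ∉ c) ∨ (f.1 ∉ c ∧ lowCube f ∈ c) then -1 else 1 := by
  rw [dualEdge, bondSpin_mk, spinAt_glue_spinsOf hc, spinAt_glue_spinsOf hc]
  by_cases h1 : f.1 ∈ c <;> by_cases h2 : lowCube f ∈ c <;> simp [h1, h2]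

/-- For a face of the complex, `[f ∈ δc] = (1 - σ_{e_f})/2`. [cite: Aizenman2025, §9.2 (proof of Thm 9.2)] -/
theorem indicator_cobd_eq {c : Finset (Probability.LatticeModels.Site 3)} (hc : c ⊆ box 3 M) {f : Plaq 3}
    (hf : f ∈ plaquettesIn (gaugeBox M)) :
    (if f ∈ cobd M c then (1 : ℝ) else 0) = (1 - bondSpin (glue (box 3 M) (spinsOf M c) .plus) (dualEdge f)) / 2 := by
  rw [bondSpin_dualEdge hc]
  have : f ∈ cobd M c ↔ (f.1 ∈ c ∧ lowCube f ∉ c) ∨ (f.1 ∉ c ∧ lowCube f ∈ c) := by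
    rw [cobd, Finset.mem_filter]; exact ⟨fun h => h.2, fun h => ⟨hf, h⟩⟩
  by_cases h : (f.1 ∈ c ∧ lowCube f ∉ c) ∨ (f.1 ∉ c ∧ lowCube f ∈ c)
  · rw [if_pos (this.2 h), if_pos h]; norm_num
  · rw [if_neg (fun h' => h (this.1 h')), if_neg h]; norm_num

/-- **The length of the domain wall `δc` (twisted by `S`) as an energy**: for `S ⊆ P`,
`2 |S ∆ δc| = |P| - ∑_{f ∈ P} ε_f σ_{e_f}`, `ε = -1` on `S`. [cite: Aizenman2025, §9.2 (proof of Thm 9.2 (2): the flip cosh ↔ sinh over the edges piercing 𝒮)] -/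
theorem two_mul_card_symmDiff_cobd {c : Finset (Probability.LatticeModels.Site 3)} (hc : c ⊆ box 3 M)
    {S : Finset (Plaq 3)} (hS : S ⊆ plaquettesIn (gaugeBox M)) :
    2 * (#(S ∆ cobd M c) : ℝ) = #(plaquettesIn (gaugeBox M)) -
      ∑ f ∈ plaquettesIn (gaugeBox M), (if f ∈ S then -1 else 1) *
        bondSpin (glue (box 3 M) (spinsOf M c) .plus) (dualEdge f) := by
  set P := plaquettesIn (gaugeBox M) with hP
  set σ := glue (box 3 M) (spinsOf M c) .plus with hσ
  have hsub : S ∆ cobd M c ⊆ P := fun f hf => by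
    rcases Finset.mem_symmDiff.1 hf with ⟨h, -⟩ | ⟨h, -⟩
    · exact hS h
    · exact cobd_subset c h
  have hcard : (#(S ∆ cobd M c) : ℝ) = ∑ f ∈ P, if f ∈ S ∆ cobd M c then (1 : ℝ) else 0 := by
    rw [← Finset.natCast_card_filter]
    congr 1
    rw [Finset.filter_mem_eq_inter, Finset.inter_eq_right.2 hsub]
  have hPcard : (#P : ℝ) = ∑ f ∈ P, (1 : ℝ) := by simp
  rw [hcard, hPcard, Finset.mul_sum, ← Finset.sum_sub_distrib]
  refine Finset.sum_congr rfl fun f hf => ?_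
  have hind := indicator_cobd_eq hc hf
  by_cases h1 : f ∈ S <;> by_cases h2 : f ∈ cobd M c <;>
    simp [Finset.mem_symmDiff, h1, h2] at hind ⊢ <;> linarith

/-! #### The dual temperature and the Boltzmann weights -/

/-- **The dual inverse temperature** `β* = -½ log tanh β`, i.e. `e^{-2β*} = tanh β`
(`e^{2β*} = coth β`). [cite: Aizenman2025, §9.2 (Thm 9.2 (1), eq. (beta_duality): e^{2β*} = coth β)] -/
def dualBeta (β : ℝ) : ℝ := -Real.log (Real.tanh β) / 2

/-- Plumbing. [folklore] -/
private theorem tanh_pos_of_pos {β : ℝ} (hβ : 0 < β) : 0 < Real.tanh β := by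
  rw [Real.tanh_eq_sinh_div_cosh]; exact div_pos (Real.sinh_pos_iff.2 hβ) (Real.cosh_pos β)

/-- Plumbing. [folklore] -/
private theorem tanh_lt_one' (β : ℝ) : Real.tanh β < 1 := by
  rw [Real.tanh_eq_sinh_div_cosh, div_lt_one (Real.cosh_pos β)]
  have := Real.cosh_sub_sinh β
  have := Real.exp_pos (-β)
  linarith

/-- `e^{-2β*} = tanh β` for `β > 0`. [cite: Aizenman2025, §9.2 (eq. (beta_duality))] -/
theorem exp_neg_two_mul_dualBeta {β : ℝ} (hβ : 0 < β) : Real.exp (-2 * dualBeta β) = Real.tanh β := by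
  rw [dualBeta, show -2 * (-Real.log (Real.tanh β) / 2) = Real.log (Real.tanh β) by ring,
    Real.exp_log (tanh_pos_of_pos hβ)]

/-- `β* > 0` for `β > 0` (`tanh β < 1`). [cite: Aizenman2025, §9.2] -/
theorem dualBeta_pos {β : ℝ} (hβ : 0 < β) : 0 < dualBeta β := by
  have : Real.log (Real.tanh β) < 0 := Real.log_neg (tanh_pos_of_pos hβ) (tanh_lt_one' β)
  rw [dualBeta]; linarith

/-- `(tanh β)^n = exp(n log tanh β)`. [folklore] -/
private theorem tanh_pow_eq_exp {β : ℝ} (hβ : 0 < β) (n : ℕ) :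
    Real.tanh β ^ n = Real.exp ((n : ℝ) * Real.log (Real.tanh β)) := by
  rw [Real.exp_nat_mul, Real.exp_log (tanh_pos_of_pos hβ)]

/-- The sum of the dual couplings is minus the plus-boundary Ising Hamiltonian at zero field.
[cite: Aizenman2025, §9.2 (eq. (Z_coth): ∑_{(u,v) ∈ ℰ*} β* σ_u σ_v)] -/
theorem sum_bondSpin_eq_neg_isingHamiltonian (σ : SpinConfig (Probability.LatticeModels.Site 3)) :
    ∑ e ∈ edgesTouching (zdGraph 3) (box 3 M), bondSpin σ e = -isingHamiltonian (zdGraph 3) (box 3 M) 0 .plus σ := by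
  rw [isingHamiltonian, BoundaryCondition.plus, interactionEdges_fixed, zero_mul, sub_zero, neg_neg]

/-- **The weight of a current as a dual Boltzmann weight** (Aizenman's cosh/sinh bookkeeping): for
`c ⊆ box 3 M` and `S ⊆ P`,
`(tanh β)^{|S ∆ δc|} = e^{(|P|/2) log tanh β} · w⁺_{β*}(σ_c) · μ_{S*}(σ_c)`, where `w⁺` is the
plus-boundary Ising Boltzmann weight at zero field, `μ_{S*} = exp(-2β* ∑_{e ∈ S*} σ_e)` the disorder
insertion on the dual bonds of `S`, and `β*` the dual temperature. [cite: Aizenman2025, §9.2 (proof of Thm 9.2, eqs. (Z_coth) and (Sdual))] -/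
theorem tanh_pow_card_symmDiff_cobd {β : ℝ} (hβ : 0 < β) {c : Finset (Probability.LatticeModels.Site 3)}
    (hc : c ⊆ box 3 M) {S : Finset (Plaq 3)} (hS : S ⊆ plaquettesIn (gaugeBox M)) :
    Real.tanh β ^ #(S ∆ cobd M c) =
      Real.exp ((#(plaquettesIn (gaugeBox M)) : ℝ) / 2 * Real.log (Real.tanh β)) *
        (isingWeight (zdGraph 3) (box 3 M) (dualBeta β) 0 .plus (spinsOf M c) *
          disorderWeight (dualBeta β) (S.image dualEdge) (glue (box 3 M) (spinsOf M c) .plus)) := by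
  set P := plaquettesIn (gaugeBox M) with hP
  set σ := glue (box 3 M) (spinsOf M c) .plus with hσ
  set L := Real.log (Real.tanh β) with hL
  have h2 := two_mul_card_symmDiff_cobd hc hS
  rw [tanh_pow_eq_exp hβ, isingWeight, disorderWeight_eq_exp_sum, ← hσ, ← Real.exp_add, ← Real.exp_add]
  congr 1
  -- the exponents agree
  have hsplit : ∑ f ∈ P, (if f ∈ S then (-1 : ℝ) else 1) * bondSpin σ (dualEdge f) =
      ∑ f ∈ P, bondSpin σ (dualEdge f) - 2 * ∑ f ∈ S, bondSpin σ (dualEdge f) := by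
    rw [← Finset.sum_sdiff hS, ← Finset.sum_sdiff hS (f := fun f => bondSpin σ (dualEdge f))]
    have ha : ∑ f ∈ P \ S, (if f ∈ S then (-1 : ℝ) else 1) * bondSpin σ (dualEdge f) =
        ∑ f ∈ P \ S, bondSpin σ (dualEdge f) :=
      Finset.sum_congr rfl fun f hf => by rw [if_neg (Finset.mem_sdiff.1 hf).2, one_mul]
    have hb : ∑ f ∈ S, (if f ∈ S then (-1 : ℝ) else 1) * bondSpin σ (dualEdge f) =
        ∑ f ∈ S, -bondSpin σ (dualEdge f) :=
      Finset.sum_congr rfl fun f hf => by rw [if_pos hf]; ring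
    rw [ha, hb, Finset.sum_neg_distrib]; ring
  have hS' : ∑ e ∈ S.image dualEdge, bondSpin σ e = ∑ f ∈ S, bondSpin σ (dualEdge f) := by
    rw [Finset.sum_image]
    exact fun f hf f' hf' h => dualEdge_injOn (lt_of_mem_faces (hS hf)) (lt_of_mem_faces (hS hf')) h
  have hE : ∑ f ∈ P, bondSpin σ (dualEdge f) =
      -isingHamiltonian (zdGraph 3) (box 3 M) 0 .plus σ := by
    rw [← sum_bondSpin_eq_neg_isingHamiltonian]
    exact (sum_edgesTouching_eq_sum_faces (fun e => bondSpin σ e)).symm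
  rw [hE] at hsplit
  rw [hsplit] at h2
  -- `h2 : 2 |S ∆ δc| = |P| - (-H - 2 ∑_S σ)`
  have hcardeq : (#(S ∆ cobd M c) : ℝ) =
      #P / 2 + isingHamiltonian (zdGraph 3) (box 3 M) 0 .plus σ / 2 + ∑ f ∈ S, bondSpin σ (dualEdge f) := by
    linarith
  rw [hcardeq, dualBeta, hS']
  ring

/-- The untwisted case `S = ∅`: `(tanh β)^{|δc|} = e^{(|P|/2) log tanh β} w⁺_{β*}(σ_c)`.
[cite: Aizenman2025, §9.2 (proof of Thm 9.2 (1), eq. (Z_coth))] -/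
theorem tanh_pow_card_cobd {β : ℝ} (hβ : 0 < β) {c : Finset (Probability.LatticeModels.Site 3)} (hc : c ⊆ box 3 M) :
    Real.tanh β ^ #(cobd M c) =
      Real.exp ((#(plaquettesIn (gaugeBox M)) : ℝ) / 2 * Real.log (Real.tanh β)) *
        isingWeight (zdGraph 3) (box 3 M) (dualBeta β) 0 .plus (spinsOf M c) := by
  have h := tanh_pow_card_symmDiff_cobd hβ hc (Finset.empty_subset (plaquettesIn (gaugeBox M)))
  rw [Finset.image_empty, disorderWeight_empty, mul_one] at h
  rwa [show (∅ : Finset (Plaq 3)) ∆ cobd M c = cobd M c from (symmDiff_comm _ _).trans (symmDiff_bot _)] at h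

/-- **Sets of cubes ↔ spin configurations of the box**: sums over `c ⊆ box 3 M` are sums over
`τ : box → {±1}`. [cite: Aizenman2025, §9.2 (proof of Thm 9.2 (1): the sum over σ : 𝒱* → {-1,+1})] -/
theorem sum_powerset_box_eq_sum_spins (F : (↥(box 3 M) → ℤˣ) → ℝ) :
    ∑ c ∈ (box 3 M).powerset, F (spinsOf M c) = ∑ τ : ↥(box 3 M) → ℤˣ, F τ := by
  classical
  refine Finset.sum_nbij' (spinsOf M)
    (fun τ => ((Finset.univ : Finset ↥(box 3 M)).filter fun y => τ y = -1).map (Function.Embedding.subtype _))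
    (fun c _ => Finset.mem_univ _) (fun τ _ => ?_) (fun c hc => ?_) (fun τ _ => ?_) (fun c _ => rfl)
  · rw [Finset.mem_powerset]
    intro y hy
    rw [Finset.mem_map] at hy
    obtain ⟨y', -, rfl⟩ := hy
    exact y'.2
  · rw [Finset.mem_powerset] at hc
    ext y
    rw [Finset.mem_map]
    constructor
    · rintro ⟨y', hy', rfl⟩
      show (y' : Probability.LatticeModels.Site 3) ∈ c
      have h := (Finset.mem_filter.1 hy').2
      unfold spinsOf at h
      by_contra hy
      rw [if_neg hy] at h
      exact absurd h (by decide)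
    · intro hy
      refine ⟨⟨y, hc hy⟩, Finset.mem_filter.2 ⟨Finset.mem_univ _, ?_⟩, rfl⟩
      unfold spinsOf; rw [if_pos hy]
  · funext y
    unfold spinsOf
    by_cases h : τ y = -1
    · rw [if_pos, h]
      exact Finset.mem_map.2 ⟨y, Finset.mem_filter.2 ⟨Finset.mem_univ _, h⟩, rfl⟩
    · rw [if_neg]
      · rcases Int.units_eq_one_or (τ y) with h' | h'
        · exact h'.symm
        · exact absurd h' h
      · intro hm
        rw [Finset.mem_map] at hm
        obtain ⟨y', hy', hyy⟩ := hm
        have : y' = y := Subtype.ext hyy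
        subst this
        exact h (Finset.mem_filter.1 hy').2

open scoped Classical in
/-- Reindexing the numerator: `n ↦ S ∆ n` is an involution of the subsets of `P ⊇ S` exchanging
«`∂(S ∆ n) = ∅`» and «`∂ n = ∅`». [cite: Aizenman2025, §9.2 (proof of Thm 9.2 (2): the insertion flips the parity rule on S)] -/
theorem sum_closed_symmDiff_reindex {P S : Finset (Plaq 3)} (hS : S ⊆ P) (g : Finset (Plaq 3) → ℝ) :
    ∑ n ∈ P.powerset with IsClosed (S ∆ n), g n = ∑ z ∈ P.powerset with IsClosed z, g (S ∆ z) := by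
  have hinv : ∀ n : Finset (Plaq 3), S ∆ (S ∆ n) = n := fun n => symmDiff_symmDiff_cancel_left S n
  have hsub : ∀ n : Finset (Plaq 3), n ⊆ P → S ∆ n ⊆ P := fun n hn =>
    (symmDiff_le_sup (a := S) (b := n)).trans (Finset.union_subset hS hn)
  refine Finset.sum_nbij' (fun n => S ∆ n) (fun z => S ∆ z) (fun n hn => ?_) (fun z hz => ?_)
    (fun n _ => hinv n) (fun z _ => hinv z) (fun n _ => by rw [hinv])
  · obtain ⟨h1, h2⟩ := Finset.mem_filter.1 hn
    exact Finset.mem_filter.2 ⟨Finset.mem_powerset.2 (hsub n (Finset.mem_powerset.1 h1)), h2⟩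
  · obtain ⟨h1, h2⟩ := Finset.mem_filter.1 hz
    exact Finset.mem_filter.2 ⟨Finset.mem_powerset.2 (hsub z (Finset.mem_powerset.1 h1)), by rwa [hinv]⟩

/-- **Aizenman 2025, Theorem 9.2 (2) (Wegner duality with free ∕ plus boundary conditions), for an
arbitrary set `S` of faces**: the free-boundary `ℤ₂` lattice-gauge expectation on the site box
`ΛG M = {-M,…,M+1}³` of the surface observable `∏_{p ∈ S} A_{∂p}` equals the plus-boundary Ising
expectation on the box of cubes `box 3 M`, at the dual temperature `β*` (`e^{-2β*} = tanh β`), of the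
disorder operator `T_{S*} = exp(-2β* ∑_{e ∈ S*} σ_e)` reversing the couplings of the dual bonds
crossing `S`:  `⟨∏_{p∈S} A_{∂p}⟩^{free}_{ΛG M, β} = ⟨T_{S*}⟩^{+}_{box 3 M, β*}`. The exterior of the
free gauge box dualises to ONE frozen `+` block (wired ∕ plus boundary condition).
[cite: Aizenman2025, §9.2 Thm 9.2 (2), eq. (Sdual)] -/
theorem zdExpect_z2_prod_plaqSpin_eq_isingExpect_plus_disorderWeight {β : ℝ} (hβ : 0 < β)
    {S : Finset (Plaq 3)} (hS : S ⊆ plaquettesIn (gaugeBox M)) :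
    zdExpect (znRep 2) β (gaugeBox M) (fun U => ∏ p ∈ S, plaqSpin U p) =
      isingExpect (zdGraph 3) (box 3 M) (dualBeta β) 0 .plus
        (disorderWeight (dualBeta β) (S.image dualEdge)) := by
  classical
  set P := plaquettesIn (gaugeBox M) with hP
  set K := Real.exp ((#P : ℝ) / 2 * Real.log (Real.tanh β)) with hK
  have hKpos : 0 < K := Real.exp_pos _
  rw [zdExpect_z2_prod_plaqSpin_eq β (gaugeBox M) S, ← hP, sum_closed_symmDiff_reindex hS,
    sum_closed_eq_sum_powerset_box (fun z => Real.tanh β ^ #(S ∆ z)),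
    sum_closed_eq_sum_powerset_box (fun z => Real.tanh β ^ #z)]
  rw [Finset.sum_congr rfl fun c hc => tanh_pow_card_symmDiff_cobd hβ (Finset.mem_powerset.1 hc) hS,
    Finset.sum_congr rfl fun c hc => tanh_pow_card_cobd hβ (Finset.mem_powerset.1 hc),
    ← Finset.mul_sum, ← Finset.mul_sum, mul_div_mul_left _ _ hKpos.ne']
  rw [sum_powerset_box_eq_sum_spins (fun τ => isingWeight (zdGraph 3) (box 3 M) (dualBeta β) 0 .plus τ *
      disorderWeight (dualBeta β) (S.image dualEdge) (glue (box 3 M) τ .plus)),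
    sum_powerset_box_eq_sum_spins (fun τ => isingWeight (zdGraph 3) (box 3 M) (dualBeta β) 0 .plus τ)]
  rw [isingExpect, integral_isingMeasure _ _ _ _ _ (measurable_disorderWeight _ _), isingPartitionFunction]

/-- **Aizenman 2025, Theorem 9.2 (2) for Wilson loops**: for a rectangular loop `γ = ∂𝒮` whose sheet
`𝒮` (`rectPlaqs`) lies in the gauge box, `⟨W_γ⟩^{free}_{ΛG M,β} = ⟨T_{𝒮*}⟩^{+}_{box 3 M,β*}` — the
free-boundary `ℤ₂` Wilson loop expectation of the tree's `zdExpect (znRep 2)` (whose cube limits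
define `znWilsonLoopLimit 2`) is a plus-boundary Ising disorder-operator expectation of the tree's
`isingExpect (zdGraph 3) · β* 0 .plus`. [cite: Aizenman2025, §9.2 Thm 9.2 (2)] -/
theorem zdExpect_z2_wilsonLoop_eq_isingExpect_plus_disorderWeight {β : ℝ} (hβ : 0 < β)
    {x : Probability.LatticeModels.Site 3} {i j : Fin 3} (hij : i < j) {R T : ℕ}
    (hS : rectPlaqs x i j R T ⊆ plaquettesIn (gaugeBox M)) :
    zdExpect (znRep 2) β (gaugeBox M) (zdWilsonLoop (znRep 2) x i j R T) =
      isingExpect (zdGraph 3) (box 3 M) (dualBeta β) 0 .plus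
        (disorderWeight (dualBeta β) ((rectPlaqs x i j R T).image dualEdge)) := by
  rw [show zdWilsonLoop (znRep 2) x i j R T = fun U => ∏ p ∈ rectPlaqs x i j R T, plaqSpin U p from
    funext fun U => zdWilsonLoop_znRep_two_eq_prod_plaqSpin x hij.ne R T U]
  exact zdExpect_z2_prod_plaqSpin_eq_isingExpect_plus_disorderWeight hβ hS

/-- **Aizenman 2025, Theorem 9.2 (1) (the partition functions)**, in the normalisation of the tree:
`∫ e^{-β S_{ΛG M}} dg_∞ = (e^{-β} cosh β)^{|P|} e^{(|P|/2) log tanh β} Z⁺_{box 3 M, β*}`, with `|P|` the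
number of faces and `Z⁺` the plus-boundary Ising partition function (`2^{|𝒱*|-1} [cosh β sinh β]^{|ℰ*|/2} Z^{Ising}` of
the source, up to Haar normalisation). [cite: Aizenman2025, §9.2 Thm 9.2 (1), eq. (eq:ZZ)] -/
theorem integral_exp_neg_zdWilsonAction_z2_eq {β : ℝ} (hβ : 0 < β) :
    ∫ U, Real.exp (-β * zdWilsonAction (znRep 2) (gaugeBox M) U) ∂zdHaar 3 ↥(rootsOfUnityCircle 2) =
      (Real.exp (-β) * Real.cosh β) ^ #(plaquettesIn (gaugeBox M)) *
        (Real.exp ((#(plaquettesIn (gaugeBox M)) : ℝ) / 2 * Real.log (Real.tanh β)) *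
          isingPartitionFunction (zdGraph 3) (box 3 M) (dualBeta β) 0 .plus) := by
  classical
  have h := integral_prod_plaqSpin_mul_exp β (gaugeBox M) (∅ : Finset (Plaq 3))
  simp only [Finset.prod_empty, one_mul] at h
  have h0 : ∀ n : Finset (Plaq 3), (∅ : Finset (Plaq 3)) ∆ n = n := fun n =>
    (symmDiff_comm _ _).trans (symmDiff_bot n)
  simp_rw [h0] at h
  rw [h, sum_closed_eq_sum_powerset_box (fun z => Real.tanh β ^ #z),
    Finset.sum_congr rfl fun c hc => tanh_pow_card_cobd hβ (Finset.mem_powerset.1 hc), ← Finset.mul_sum,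
    sum_powerset_box_eq_sum_spins, isingPartitionFunction]

end Dual

end Z2Duality

end Literature.MathematicalPhysics.QuantumFieldTheory
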